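import Literature.Computability.QuantumComplexity.ZXCalculusHangingBranch
import HarnessLib

/-!
# ZX-calculus: Lemma 34 bent (Hadamard-branch form) and the middle of Appendix Lemma 35

The assembly of **Appendix Lemma 34** (`ZXClass.L34`, from `L34_forward`, the mirror image of rule (C) and the permutation
bookkeeping), its colour-swapped and Hadamard-branch forms (`L34_colorSwap`, `L34h`), its two bendings
(`Y_L`, `Y_R`), the middle step of the proof of **Appendix Lemma 35** (`L35_mid`), the two halves of the Lemma-35 chain
(`L35_left`, `L35_right`, via the bialgebra step `xLeafL_split_xLeafL_eq`, supplementarity `gadgets_cancel_*`, `top_picom`,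
Euler/colour-change steps and `E4_prime` = Lemma (control-π and anti-CNOT commute) transposed), and finally
**Appendix Lemma 35** itself: `triangle_through_W` (the triangle passes through the W-fork).
[cite: JeandelPerdrixVilmart2018, Appendix, Lemmas 34, 35 and their proofs]
-/


/-!
# ZX-calculus: the mirror image of rule (C) and Appendix Lemma 34 (assembly)
[cite: JeandelPerdrixVilmart2018, Fig. 1 rule (C); Appendix, Lemma 34]
-/

namespace Literature.Computability.QuantumComplexity

open ZXDiagram

namespace ZXClass

/-- `X^{(1,3)}` absorbs a swap of its last two outputs (private copy of the `ZXCalculusTransistor` lemma). [cite: JeandelPerdrixVilmart2018, Fig. 1 (S1)] -/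
private theorem hbb_X_one_three_seq_par_swap : mk (X 1 3 0) ⨟ (mk (wires 1) ⊠ mk swap) = mk (X 1 3 0) := by
  have h := congrArg colorSwap Z_one_three_seq_par_swap
  simpa using h

/-- `X^{(1,2)} ⨾ (X^{(1,2)} ⊗ 𝕀) = X^{(1,3)}` (private copy of the `ZXCalculusTransistor` lemma). [cite: JeandelPerdrixVilmart2018, Fig. 1 (S1)] -/
private theorem hbb_xsplit_seq_xsplit_par : mk (X 1 2 0) ⨟ (mk (X 1 2 0) ⊠ mk (wires 1)) = mk (X 1 3 0) := by
  have h := congrArg colorSwap (Z_seq_Z_par 1 1 1 2 le_rfl 0 0)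
  simpa using h

/-- Regrouping (bookkeeping): `(A ⊗ 𝕀) ⊗ 𝕀 = A ⊗ 𝕀²` for `A : 2 → 2`. [folklore] -/
private theorem rg22b (A : ZXClass 2 2) : (A ⊠ mk (wires 1)) ⊠ mk (wires 1) = A ⊠ mk (wires 2) := by
  rw [← wires_par_wires 1 1]; exact (par_assoc _ _ _).trans (cast_id _ _ _)

/-- Naturality of the swap for a copy-then-merge block: `σ ⨾ CN_{c,h} = NC_{c,h} ⨾ σ`, where
`CN_{c,h} := (𝕀 ⊗ Z^{(1,2)}(c)) ⨾ (X^{(2,1)}(h) ⊗ 𝕀)` and `NC_{c,h}` is its mirror image.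
[folklore] (PROP axioms and the symmetry of the generators, JeandelPerdrixVilmart2018 §2.1) -/
theorem swap_seq_copyMerge (c h : ZMod 8) :
    mk swap ⨟ ((mk (wires 1) ⊠ mk (Z 1 2 c)) ⨟ (mk (X 2 1 h) ⊠ mk (wires 1))) = ((mk (Z 1 2 c) ⊠ mk (wires 1)) ⨟ (mk (wires 1) ⊠ mk (X 2 1 h))) ⨟ mk swap := by
  have h1 : (mk (Z 1 2 c) ⊠ mk (wires 1)) ⨟ ((mk (wires 1) ⊠ mk swap) ⨟ (mk swap ⊠ mk (wires 1))) = mk swap ⨟ (mk (wires 1) ⊠ mk (Z 1 2 c)) := by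
    rw [← bswap1_two, ← bswap1_one]; exact swap_nat _
  have h2 : (mk (wires 1) ⊠ mk (X 2 1 h)) ⨟ mk swap = ((mk swap ⊠ mk (wires 1)) ⨟ (mk (wires 1) ⊠ mk swap)) ⨟ (mk (X 2 1 h) ⊠ mk (wires 1)) := by
    rw [← fswap1_two, ← fswap1_one]; exact wires_par_seq_fswap1 _
  rw [← seq_assoc, ← h1, seq_assoc, seq_assoc, ← seq_par_wires (mk swap) (mk (X 2 1 h)) 1, swap_seq_X]
  nth_rewrite 1 [← Z_seq_swap 1 c]
  rw [seq_par_wires, seq_assoc, ← seq_assoc (mk swap ⊠ mk (wires 1)) (mk (wires 1) ⊠ mk swap) _, ← h2, ← seq_assoc]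

/-- The order-reversing permutation of three wires passes a block on the first two wires to the mirrored block on the
last two wires. [folklore] (PROP axioms) -/
theorem rev3_seq_par_wires (A B : ZXClass 2 2) (h : mk swap ⨟ A = B ⨟ mk swap) :
    ((mk swap ⊠ mk (wires 1)) ⨟ (mk (wires 1) ⊠ mk swap) ⨟ (mk swap ⊠ mk (wires 1))) ⨟ (A ⊠ mk (wires 1)) = (mk (wires 1) ⊠ B) ⨟ ((mk swap ⊠ mk (wires 1)) ⨟ (mk (wires 1) ⊠ mk swap) ⨟ (mk swap ⊠ mk (wires 1))) := by
  have hf : (mk (wires 1) ⊠ B) ⨟ ((mk swap ⊠ mk (wires 1)) ⨟ (mk (wires 1) ⊠ mk swap)) = ((mk swap ⊠ mk (wires 1)) ⨟ (mk (wires 1) ⊠ mk swap)) ⨟ (B ⊠ mk (wires 1)) := by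
    rw [← fswap1_two]; exact wires_par_seq_fswap1 _
  rw [seq_assoc, ← seq_par_wires, h, seq_par_wires, ← seq_assoc, ← hf, seq_assoc]

/-- The order-reversing permutation of three wires passes a block on the last two wires to the mirrored block on the
first two wires. [folklore] (PROP axioms) -/
theorem rev3_seq_wires_par (A B : ZXClass 2 2) (h : mk swap ⨟ A = B ⨟ mk swap) :
    ((mk swap ⊠ mk (wires 1)) ⨟ (mk (wires 1) ⊠ mk swap) ⨟ (mk swap ⊠ mk (wires 1))) ⨟ (mk (wires 1) ⊠ A) = (B ⊠ mk (wires 1)) ⨟ ((mk swap ⊠ mk (wires 1)) ⨟ (mk (wires 1) ⊠ mk swap) ⨟ (mk swap ⊠ mk (wires 1))) := by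
  have hb : ((mk (wires 1) ⊠ mk swap) ⨟ (mk swap ⊠ mk (wires 1))) ⨟ (mk (wires 1) ⊠ A) = (A ⊠ mk (wires 1)) ⨟ ((mk (wires 1) ⊠ mk swap) ⨟ (mk swap ⊠ mk (wires 1))) := by
    rw [← bswap1_two]; exact bswap1_seq_wires_par _
  rw [seq_assoc (mk swap ⊠ mk (wires 1)) (mk (wires 1) ⊠ mk swap) (mk swap ⊠ mk (wires 1)), seq_assoc, hb, ← seq_assoc, ← seq_par_wires, h, seq_par_wires,
    seq_assoc]

/-- The order-reversing permutation of three wires followed by a green merge of the first two: the merge moves to the last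
two wires and a swap remains. [folklore] (PROP axioms and rule (S)) -/
theorem rev3_seq_Z_two_one_par (a : ZMod 8) :
    ((mk swap ⊠ mk (wires 1)) ⨟ (mk (wires 1) ⊠ mk swap) ⨟ (mk swap ⊠ mk (wires 1))) ⨟ (mk (Z 2 1 a) ⊠ mk (wires 1)) = (mk (wires 1) ⊠ mk (Z 2 1 a)) ⨟ mk swap := by
  rw [seq_assoc, ← seq_par_wires, swap_seq_Z, ← fswap1_two, fswap1_nat, fswap1_one]

/-- The left-hand side of rule (C), unfolded. [cite: JeandelPerdrixVilmart2018, Fig. 1 rule (C)] -/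
theorem mk_cLhs (a b g : ZMod 8) : mk (cLhs a b g) = (((mk (wires 1) ⊠ mk (Z 1 2 0)) ⊠ mk (wires 1)) ⨟ ((mk (X 2 1 (-g)) ⊠ mk (wires 1)) ⊠ mk (Z 1 2 b)) ⨟ ((mk (wires 1) ⊠ mk (X 2 1 g)) ⊠ mk (wires 1)) ⨟ (mk (Z 2 1 a) ⊠ mk (wires 1)) ⨟ (mk (xLeafL 0 a) ⊠ mk (xLeafR 4 b)) ⨟ mk (Z 2 1 0)) := by
  simp only [cLhs, mk_seq, mk_par]

/-- **Rule (C), left-hand side factored** through the copy-then-merge blocks `CN`. [cite: JeandelPerdrixVilmart2018, Fig. 1 rule (C)] -/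
theorem cLhs_factor (a b g : ZMod 8) :
    mk (cLhs a b g) = (((mk (wires 1) ⊠ mk (Z 1 2 0)) ⨟ (mk (X 2 1 (-g)) ⊠ mk (wires 1))) ⊠ mk (wires 1)) ⨟ (mk (wires 1) ⊠ ((mk (wires 1) ⊠ mk (Z 1 2 b)) ⨟ (mk (X 2 1 g) ⊠ mk (wires 1)))) ⨟ (mk (Z 2 1 a) ⊠ mk (wires 1)) ⨟ (mk (xLeafL 0 a) ⊠ mk (xLeafR 4 b)) ⨟ mk (Z 2 1 0) := by
  have e2 : (mk (X 2 1 (-g)) ⊠ mk (wires 1)) ⊠ mk (Z 1 2 b) = ((mk (X 2 1 (-g)) ⊠ mk (wires 1)) ⊠ mk (wires 1)) ⨟ (mk (wires 1) ⊠ (mk (wires 1) ⊠ mk (Z 1 2 b))) := by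
    rw [show mk (wires 1) ⊠ (mk (wires 1) ⊠ mk (Z 1 2 b)) = mk (wires 2) ⊠ mk (Z 1 2 b) from by rw [← wires_par_wires 1 1]; exact (par_assoc' _ _ _).trans (cast_id _ _ _),
      interchange, seq_id, id_seq]
  have e3 : (mk (wires 1) ⊠ mk (X 2 1 g)) ⊠ mk (wires 1) = mk (wires 1) ⊠ (mk (X 2 1 g) ⊠ mk (wires 1)) := (par_assoc _ _ _).trans (cast_id _ _ _)
  have key : ((mk (wires 1) ⊠ mk (Z 1 2 0)) ⊠ mk (wires 1)) ⨟ ((mk (X 2 1 (-g)) ⊠ mk (wires 1)) ⊠ mk (Z 1 2 b)) ⨟ ((mk (wires 1) ⊠ mk (X 2 1 g)) ⊠ mk (wires 1)) = (((mk (wires 1) ⊠ mk (Z 1 2 0)) ⨟ (mk (X 2 1 (-g)) ⊠ mk (wires 1))) ⊠ mk (wires 1)) ⨟ (mk (wires 1) ⊠ ((mk (wires 1) ⊠ mk (Z 1 2 b)) ⨟ (mk (X 2 1 g) ⊠ mk (wires 1)))) := by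
    rw [e2, e3, seq_par_wires, wires_par_seq]; simp only [seq_assoc]
  rw [mk_cLhs, key]

/-- **Rule (C), right-hand side factored** through the mirrored blocks `NC`. [cite: JeandelPerdrixVilmart2018, Fig. 1 rule (C)] -/
theorem cRhs_factor (a b g : ZMod 8) :
    mk (cRhs a b g) = (mk (wires 1) ⊠ ((mk (Z 1 2 0) ⊠ mk (wires 1)) ⨟ (mk (wires 1) ⊠ mk (X 2 1 g)))) ⨟ (((mk (Z 1 2 b) ⊠ mk (wires 1)) ⨟ (mk (wires 1) ⊠ mk (X 2 1 (-g)))) ⊠ mk (wires 1)) ⨟ (mk (wires 1) ⊠ mk (Z 2 1 a)) ⨟ (mk (xLeafL 4 b) ⊠ mk (xLeafR 0 a)) ⨟ mk (Z 2 1 0) := by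
  have e1 : (mk (wires 1) ⊠ mk (Z 1 2 0)) ⊠ mk (wires 1) = mk (wires 1) ⊠ (mk (Z 1 2 0) ⊠ mk (wires 1)) := (par_assoc _ _ _).trans (cast_id _ _ _)
  have e2 : (mk (Z 1 2 b) ⊠ mk (wires 1)) ⊠ mk (X 2 1 g) = (mk (wires 1) ⊠ (mk (wires 1) ⊠ mk (X 2 1 g))) ⨟ ((mk (Z 1 2 b) ⊠ mk (wires 1)) ⊠ mk (wires 1)) := by
    rw [show mk (wires 1) ⊠ (mk (wires 1) ⊠ mk (X 2 1 g)) = mk (wires 2) ⊠ mk (X 2 1 g) from by rw [← wires_par_wires 1 1]; exact (par_assoc' _ _ _).trans (cast_id _ _ _),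
      interchange, seq_id, id_seq]
  have key : ((mk (wires 1) ⊠ mk (Z 1 2 0)) ⊠ mk (wires 1)) ⨟ ((mk (Z 1 2 b) ⊠ mk (wires 1)) ⊠ mk (X 2 1 g)) ⨟ ((mk (wires 1) ⊠ mk (X 2 1 (-g))) ⊠ mk (wires 1)) = (mk (wires 1) ⊠ ((mk (Z 1 2 0) ⊠ mk (wires 1)) ⨟ (mk (wires 1) ⊠ mk (X 2 1 g)))) ⨟ (((mk (Z 1 2 b) ⊠ mk (wires 1)) ⨟ (mk (wires 1) ⊠ mk (X 2 1 (-g)))) ⊠ mk (wires 1)) := by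
    rw [e1, e2, wires_par_seq, seq_par_wires]; simp only [seq_assoc]
  simp only [cRhs, mk_seq, mk_par]
  rw [key]

/-- **Rule (C) mirrored**: the right-hand side of rule (C) is its left-hand side with `γ ↦ -γ`, read through the
order-reversing permutation of the three inputs. [cite: JeandelPerdrixVilmart2018, Fig. 1 rule (C) (the rule is drawn up to
this symmetry); PROP axioms] -/
theorem cRhs_eq_rev3_seq_cLhs (a b g : ZMod 8) :
    mk (cRhs a b g) = ((mk swap ⊠ mk (wires 1)) ⨟ (mk (wires 1) ⊠ mk swap) ⨟ (mk swap ⊠ mk (wires 1))) ⨟ mk (cLhs a b (-g)) := by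
  rw [cRhs_factor, cLhs_factor, neg_neg]
  rw [← seq_assoc ((mk swap ⊠ mk (wires 1)) ⨟ (mk (wires 1) ⊠ mk swap) ⨟ (mk swap ⊠ mk (wires 1))) _ (mk (Z 2 1 0)), ← seq_assoc ((mk swap ⊠ mk (wires 1)) ⨟ (mk (wires 1) ⊠ mk swap) ⨟ (mk swap ⊠ mk (wires 1))) _ (mk (xLeafL 0 a) ⊠ mk (xLeafR 4 b)), ← seq_assoc ((mk swap ⊠ mk (wires 1)) ⨟ (mk (wires 1) ⊠ mk swap) ⨟ (mk swap ⊠ mk (wires 1))) _ (mk (Z 2 1 a) ⊠ mk (wires 1)),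
    ← seq_assoc ((mk swap ⊠ mk (wires 1)) ⨟ (mk (wires 1) ⊠ mk swap) ⨟ (mk swap ⊠ mk (wires 1))) (((mk (wires 1) ⊠ mk (Z 1 2 0)) ⨟ (mk (X 2 1 g) ⊠ mk (wires 1))) ⊠ mk (wires 1)) (mk (wires 1) ⊠ ((mk (wires 1) ⊠ mk (Z 1 2 b)) ⨟ (mk (X 2 1 (-g)) ⊠ mk (wires 1)))), rev3_seq_par_wires _ _ (swap_seq_copyMerge 0 g), seq_assoc _ ((mk swap ⊠ mk (wires 1)) ⨟ (mk (wires 1) ⊠ mk swap) ⨟ (mk swap ⊠ mk (wires 1))) (mk (wires 1) ⊠ ((mk (wires 1) ⊠ mk (Z 1 2 b)) ⨟ (mk (X 2 1 (-g)) ⊠ mk (wires 1)))),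
    rev3_seq_wires_par _ _ (swap_seq_copyMerge b (-g)), ← seq_assoc _ _ ((mk swap ⊠ mk (wires 1)) ⨟ (mk (wires 1) ⊠ mk swap) ⨟ (mk swap ⊠ mk (wires 1))), seq_assoc _ ((mk swap ⊠ mk (wires 1)) ⨟ (mk (wires 1) ⊠ mk swap) ⨟ (mk swap ⊠ mk (wires 1))) (mk (Z 2 1 a) ⊠ mk (wires 1)),
    rev3_seq_Z_two_one_par, ← seq_assoc _ _ (mk swap), seq_assoc _ (mk swap) (mk (xLeafL 0 a) ⊠ mk (xLeafR 4 b)), swap_seq_par_one_one,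
    ← xLeafL_eq_xLeafR 4 b, xLeafL_eq_xLeafR 0 a, ← seq_assoc _ _ (mk swap), seq_assoc _ (mk swap) (mk (Z 2 1 0)), swap_seq_Z]

/-- Four-wire permutation words: `σ₁ σ₃ = σ₃ σ₁`. [folklore] (PROP axioms) -/
private theorem t1_seq_t3 : ((mk swap ⊠ mk (wires 1)) ⊠ mk (wires 1)) ⨟ (mk (wires 2) ⊠ mk swap) = (mk (wires 2) ⊠ mk swap) ⨟ ((mk swap ⊠ mk (wires 1)) ⊠ mk (wires 1)) := by
  rw [rg22b, interchange, seq_id, id_seq, interchange, seq_id, id_seq]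

/-- Four-wire permutation words: `σ₁ σ₃ R = σ₃ σ₁ R`. [folklore] (PROP axioms) -/
private theorem t1_seq_t3_cps {n : ℕ} (R : ZXClass 4 n) : ((mk swap ⊠ mk (wires 1)) ⊠ mk (wires 1)) ⨟ ((mk (wires 2) ⊠ mk swap) ⨟ R) = (mk (wires 2) ⊠ mk swap) ⨟ (((mk swap ⊠ mk (wires 1)) ⊠ mk (wires 1)) ⨟ R) := by
  rw [← seq_assoc, t1_seq_t3, seq_assoc]

/-- Four-wire permutation words: `σ₁ σ₁ R = R`. [folklore] (PROP axioms) -/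
private theorem t1_seq_t1_cps {n : ℕ} (R : ZXClass 4 n) : ((mk swap ⊠ mk (wires 1)) ⊠ mk (wires 1)) ⨟ (((mk swap ⊠ mk (wires 1)) ⊠ mk (wires 1)) ⨟ R) = R := by
  rw [← seq_assoc, rg22b, ← seq_par_wires, swap_seq_swap, wires_par_wires, id_seq]

/-- Four-wire permutation words: the braid relation `σ₂ σ₃ σ₂ = σ₃ σ₂ σ₃` (Yang–Baxter on the last three wires).
[folklore] (PROP axioms) -/
private theorem t2_t3_t2 : ((mk (wires 1) ⊠ mk swap) ⊠ mk (wires 1)) ⨟ ((mk (wires 2) ⊠ mk swap) ⨟ ((mk (wires 1) ⊠ mk swap) ⊠ mk (wires 1))) = (mk (wires 2) ⊠ mk swap) ⨟ (((mk (wires 1) ⊠ mk swap) ⊠ mk (wires 1)) ⨟ (mk (wires 2) ⊠ mk swap)) := by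
  rw [show ((mk (wires 1) ⊠ mk swap) ⊠ mk (wires 1)) = mk (wires 1) ⊠ (mk swap ⊠ mk (wires 1)) from (par_assoc _ _ _).trans (cast_id _ _ _),
    show (mk (wires 2) ⊠ mk swap) = mk (wires 1) ⊠ (mk (wires 1) ⊠ mk swap) from by rw [← wires_par_wires 1 1]; exact (par_assoc _ _ _).trans (cast_id _ _ _),
    ← wires_par_seq, ← wires_par_seq, ← wires_par_seq, ← wires_par_seq, ← seq_assoc, yang_baxter, seq_assoc]

/-- Four-wire permutation words: `σ₂ σ₃ σ₂ R = σ₃ σ₂ σ₃ R`. [folklore] (PROP axioms) -/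
private theorem braid_cps {n : ℕ} (R : ZXClass 4 n) : ((mk (wires 1) ⊠ mk swap) ⊠ mk (wires 1)) ⨟ ((mk (wires 2) ⊠ mk swap) ⨟ (((mk (wires 1) ⊠ mk swap) ⊠ mk (wires 1)) ⨟ R)) = (mk (wires 2) ⊠ mk swap) ⨟ (((mk (wires 1) ⊠ mk swap) ⊠ mk (wires 1)) ⨟ ((mk (wires 2) ⊠ mk swap) ⨟ R)) := by
  rw [← seq_assoc (mk (wires 2) ⊠ mk swap) ((mk (wires 1) ⊠ mk swap) ⊠ mk (wires 1)) R, ← seq_assoc ((mk (wires 1) ⊠ mk swap) ⊠ mk (wires 1)) ((mk (wires 2) ⊠ mk swap) ⨟ ((mk (wires 1) ⊠ mk swap) ⊠ mk (wires 1))) R, t2_t3_t2, seq_assoc, seq_assoc]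

/-- **Routing a state inserted between two inputs past the order-reversing permutation**: for a two-legged state `S`
inserted between the inputs (second leg routed past the second input), reversing (first input, first leg, second input)
is the same as swapping the two inputs first. [folklore] (PROP axioms) -/
theorem plug_perm (S : ZXClass 0 2) :
    (((mk (wires 1) ⊠ S) ⊠ mk (wires 1)) ⨟ ((mk (wires 1) ⊠ mk (wires 1)) ⊠ mk swap)) ⨟ (((mk swap ⊠ mk (wires 1)) ⨟ (mk (wires 1) ⊠ mk swap) ⨟ (mk swap ⊠ mk (wires 1))) ⊠ mk (wires 1)) = mk swap ⨟ (((mk (wires 1) ⊠ S) ⊠ mk (wires 1)) ⨟ ((mk (wires 1) ⊠ mk (wires 1)) ⊠ mk swap)) := by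
  have hS : mk (wires 1) ⊠ S = (S ⊠ mk (wires 1)) ⨟ ((mk (wires 1) ⊠ mk swap) ⨟ (mk swap ⊠ mk (wires 1))) := by
    have h := bswap1_seq_wires_par S
    rw [bswap1_zero, bswap1_two] at h
    exact (id_seq _).symm.trans h
  have hreg : (mk (wires 1) ⊠ S) ⊠ mk (wires 1) = mk (wires 1) ⊠ (S ⊠ mk (wires 1)) := (par_assoc _ _ _).trans (cast_id _ _ _)
  have hb : mk swap ⨟ (mk (wires 1) ⊠ (S ⊠ mk (wires 1))) = ((S ⊠ mk (wires 1)) ⊠ mk (wires 1)) ⨟ mk (bswap1 3) := by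
    rw [← bswap1_one]; exact bswap1_seq_wires_par _
  have h3 : mk (bswap1 3) = (mk (wires 2) ⊠ mk swap) ⨟ (((mk (wires 1) ⊠ mk swap) ⨟ (mk swap ⊠ mk (wires 1))) ⊠ mk (wires 1)) := by
    rw [bswap1_succ 2, mk_seq, mk_par, mk_par, bswap1_two]
  rw [wires_par_wires 1 1]
  conv_rhs => rw [← seq_assoc, hreg, hb, h3, seq_par_wires]
  conv_lhs => rw [hS, seq_par_wires, seq_par_wires, seq_par_wires, seq_par_wires]
  simp only [seq_assoc]
  rw [t1_seq_t3_cps, t1_seq_t1_cps, braid_cps, ← t1_seq_t3]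

/-- Scalar mover (bookkeeping): `A ⨾ (s ⊗ B) = s ⊗ (A ⨾ B)` for `A : 2 → 2`, `B : 2 → 1`. [folklore] -/
private theorem mvr_2_2_1 (A : ZXClass 2 2) (s : ZXClass 0 0) (B : ZXClass 2 1) : A ⨟ (s ⊠ B) = s ⊠ (A ⨟ B) := by
  rw [scalar_par_seq_right, empty_par, cast_id]

/-- **Appendix Lemma 34** of JPV (LICS'18): exchanging the red phases `∓γ` on the first input and on the bridge of the
Lemma-34 diagram is the same as swapping its two inputs:
`L(−γ, γ) = σ ⨾ L(γ, −γ)`. Proof as printed (figs. `…-proof-fin_00–04`): both sides are brought to the common form of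
`L34_forward`, where the phases sit in an instance of rule (C); rule (C) and its mirror symmetry exchange them, and the
order-reversing permutation this produces is absorbed by the symmetric root state and the swap of the inputs.
[cite: JeandelPerdrixVilmart2018, Appendix, Lemma 34 and its proof] -/
theorem L34 (a b g : ZMod 8) : ((mk (X 1 1 (-g)) ⊠ mk (wires 1)) ⨟ (mk (Z 1 3 0) ⊠ mk (Z 1 2 b)) ⨟ (((mk (X 1 0 a) ⊠ mk (wires 1)) ⊠ ((mk (X 1 1 g) ⊠ mk (wires 1)) ⨟ mk cap)) ⊠ mk (wires 1)) ⨟ (mk (X 1 1 a) ⊠ mk (X 1 2 4)) ⨟ (mk (Z 2 1 0) ⊠ mk (Z 1 0 b))) = mk swap ⨟ (((mk (X 1 1 g) ⊠ mk (wires 1)) ⨟ (mk (Z 1 3 0) ⊠ mk (Z 1 2 b)) ⨟ (((mk (X 1 0 a) ⊠ mk (wires 1)) ⊠ ((mk (X 1 1 (-g)) ⊠ mk (wires 1)) ⨟ mk cap)) ⊠ mk (wires 1)) ⨟ (mk (X 1 1 a) ⊠ mk (X 1 2 4)) ⨟ (mk (Z 2 1 0) ⊠ mk (Z 1 0 b))))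 := by
  rw [L34_forward, L34_forward, ← mk_cLhs 1 b g, rule_C, cRhs_eq_rev3_seq_cLhs, mk_cLhs, neg_neg,
    seq_par_wires ((mk swap ⊠ mk (wires 1)) ⨟ (mk (wires 1) ⊠ mk swap) ⨟ (mk swap ⊠ mk (wires 1))) _ 1, ← seq_assoc (((mk (wires 1) ⊠ (mk (X 0 1 a) ⨟ mk (Z 1 2 0) ⨟ (mk (X 1 1 2) ⊠ mk (X 1 1 a)))) ⊠ mk (wires 1)) ⨟ ((mk (wires 1) ⊠ mk (wires 1)) ⊠ mk swap)) (((mk swap ⊠ mk (wires 1)) ⨟ (mk (wires 1) ⊠ mk swap) ⨟ (mk swap ⊠ mk (wires 1))) ⊠ mk (wires 1)) _, plug_perm,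
    seq_assoc (mk swap) (((mk (wires 1) ⊠ (mk (X 0 1 a) ⨟ mk (Z 1 2 0) ⨟ (mk (X 1 1 2) ⊠ mk (X 1 1 a)))) ⊠ mk (wires 1)) ⨟ ((mk (wires 1) ⊠ mk (wires 1)) ⊠ mk swap)) _, seq_assoc (mk swap) _ ((((mk (wires 1) ⊠ mk (wires 1)) ⊠ (mk (Z 0 1 0) ⨟ mk triangle)) ⊠ ((mk (Z 0 1 (-1)) ⊠ mk (Z 0 1 (-1))) ⨟ mk (X 2 1 0))) ⨟ mk (Z 4 1 0)), mvr_2_2_1, mvr_2_2_1]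

end ZXClass

end Literature.Computability.QuantumComplexity


/-!
# ZX-calculus: Appendix Lemma 34 colour-swapped and in Hadamard-branch form (towards Lemma 35)
[cite: JeandelPerdrixVilmart2018, Appendix, Lemmas 34, 35]
-/

namespace Literature.Computability.QuantumComplexity

open ZXDiagram

namespace ZXClass

/-- **Appendix Lemma 34, colour-swapped.** [cite: JeandelPerdrixVilmart2018, Appendix Lemma 34; rule (H) / colour symmetry §2] -/
theorem L34_colorSwap (a b g : ZMod 8) : (mk (Z 1 1 (-g)) ⊠ mk (wires 1)) ⨟ (mk (X 1 3 0) ⊠ mk (X 1 2 b)) ⨟ (((mk (Z 1 0 a) ⊠ mk (wires 1)) ⊠ ((mk (Z 1 1 g) ⊠ mk (wires 1)) ⨟ mk cap)) ⊠ mk (wires 1)) ⨟ (mk (Z 1 1 a) ⊠ mk (Z 1 2 4)) ⨟ (mk (X 2 1 0) ⊠ mk (X 1 0 b)) = mk swap ⨟ ((mk (Z 1 1 g) ⊠ mk (wires 1)) ⨟ (mk (X 1 3 0) ⊠ mk (X 1 2 b)) ⨟ (((mk (Z 1 0 a) ⊠ mk (wires 1)) ⊠ ((mk (Z 1 1 (-g))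 ⊠ mk (wires 1)) ⨟ mk cap)) ⊠ mk (wires 1)) ⨟ (mk (Z 1 1 a) ⊠ mk (Z 1 2 4)) ⨟ (mk (X 2 1 0) ⊠ mk (X 1 0 b))) := by
  rw [← colorSwap_inj]
  simp only [colorSwap_seq, colorSwap_par, colorSwap_mk, ZXDiagram.colorSwap_Z, ZXDiagram.colorSwap_X, ZXDiagram.colorSwap_wires,
    ZXDiagram.colorSwap_swap, ZXDiagram.colorSwap_cap]
  exact L34 a b g

/-- Scalar mover (bookkeeping): `𝕀 ⊗ (s ⊗ B) = s ⊗ (𝕀 ⊗ B)` for an effect `B`. [folklore] -/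
private theorem m4_w_s_10 (s : ZXClass 0 0) (B : ZXClass 1 0) : mk (wires 1) ⊠ (s ⊠ B) = s ⊠ (mk (wires 1) ⊠ B) := by
  rw [show mk (wires 1) ⊠ (s ⊠ B) = ((mk (wires 1) ⊠ s) ⊠ B).cast rfl rfl from (par_assoc' _ _ _).trans rfl, cast_id, ← scalar_par_wires,
    show (s ⊠ mk (wires 1)) ⊠ B = (s ⊠ (mk (wires 1) ⊠ B)).cast rfl rfl from (par_assoc _ _ _).trans rfl, cast_id]

/-- Scalar mover (bookkeeping): `A ⨾ (s ⊗ B) = s ⊗ (A ⨾ B)` for `A : 1 → 2`, `B : 2 → 1`. [folklore] -/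
private theorem m4_r121 (A : ZXClass 1 2) (s : ZXClass 0 0) (B : ZXClass 2 1) : A ⨟ (s ⊠ B) = s ⊠ (A ⨟ B) := by
  rw [scalar_par_seq_right, empty_par, cast_id]

/-- Scalar mover (bookkeeping): `A ⨾ (s ⊗ B) = s ⊗ (A ⨾ B)` for `A : 2 → 2`, `B : 2 → 2`. [folklore] -/
private theorem m4_r222 (A : ZXClass 2 2) (s : ZXClass 0 0) (B : ZXClass 2 2) : A ⨟ (s ⊠ B) = s ⊠ (A ⨟ B) := by
  rw [scalar_par_seq_right, empty_par, cast_id]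

/-- Scalar mover (bookkeeping): `A ⨾ (s ⊗ B) = s ⊗ (A ⨾ B)` for `A : 2 → 2`, `B : 2 → 1`. [folklore] -/
private theorem m4_r221 (A : ZXClass 2 2) (s : ZXClass 0 0) (B : ZXClass 2 1) : A ⨟ (s ⊠ B) = s ⊠ (A ⨟ B) := by
  rw [scalar_par_seq_right, empty_par, cast_id]

/-- Scalar mover (bookkeeping): `(s ⊗ A) ⨾ B = s ⊗ (A ⨾ B)` for `A : 2 → 2`, `B : 2 → 1`. [folklore] -/
private theorem m4_l221 (s : ZXClass 0 0) (A : ZXClass 2 2) (B : ZXClass 2 1) : (s ⊠ A) ⨟ B = s ⊠ (A ⨟ B) := by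
  rw [scalar_par_seq_left, empty_par, cast_id]

/-- Scalar mover (bookkeeping): `(s ⊗ A) ⨾ B = s ⊗ (A ⨾ B)` for `A : 2 → 1`, `B : 1 → 1`. [folklore] -/
private theorem m4_l211 (s : ZXClass 0 0) (A : ZXClass 2 1) (B : ZXClass 1 1) : (s ⊠ A) ⨟ B = s ⊠ (A ⨟ B) := by
  rw [scalar_par_seq_left, empty_par, cast_id]

/-- Scalar mover (bookkeeping): `A ⊗ (s ⊗ B) = s ⊗ (A ⊗ B)` for `A B : 1 → 1`. [folklore] -/
private theorem m4_p11 (A : ZXClass 1 1) (s : ZXClass 0 0) (B : ZXClass 1 1) : A ⊠ (s ⊠ B) = s ⊠ (A ⊠ B) := by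
  rw [par_eq_seq_left A (s ⊠ B), ← scalar_par_wires_par_one, m4_r222, ← par_eq_seq_left]

/-- The green `π` node with a red `π/2` leaf on the second leg of a `Z^{(1,2)}`: `Z^{(1,2)}(π) ⨾ (𝕀 ⊗ X^{(1,0)}(π/2)) = (1/√2)·Z_0(π/2) ⊗ Z(π/2)`.
[cite: JeandelPerdrixVilmart2018, rules (S1), (K); via `X_effect_two`] -/
theorem Z_pi_split_seq_par_X_effect_two : mk (Z 1 2 4) ⨟ (mk (wires 1) ⊠ mk (X 1 0 2)) = mk invSqrtTwo ⊠ (mk (Z 0 0 2) ⊠ mk (Z 1 1 2)) := by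
  rw [X_effect_two, m4_w_s_10, m4_w_s_10, m4_r121, m4_r121, Z_seq_par_Z 1 1 1 0 le_rfl, show (4 : ZMod 8) + -2 = 2 from by decide]

/-- The last two layers of the colour-swapped Lemma-34 diagram (`α = π/4`, `β = π/2`): the `π`-node with its red leaf is a green
`π/2` phase up to `(1/√2)·Z_0(π/2)`. [cite: JeandelPerdrixVilmart2018, Appendix Lemma 34 (colour-swapped), rules (S1), (K)] -/
theorem L34c_tail : (mk (Z 1 1 1) ⊠ mk (Z 1 2 4)) ⨟ (mk (X 2 1 0) ⊠ mk (X 1 0 2)) = mk invSqrtTwo ⊠ (mk (Z 0 0 2) ⊠ ((mk (Z 1 1 1) ⊠ mk (Z 1 1 2)) ⨟ mk (X 2 1 0))) := by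
  have h2 : (mk (Z 1 1 1) ⊠ mk (Z 1 2 4)) ⨟ (mk (wires 2) ⊠ mk (X 1 0 2)) = mk (Z 1 1 1) ⊠ (mk (Z 1 2 4) ⨟ (mk (wires 1) ⊠ mk (X 1 0 2))) := by
    rw [← wires_par_wires 1 1, show (mk (wires 1) ⊠ mk (wires 1)) ⊠ mk (X 1 0 2) = mk (wires 1) ⊠ (mk (wires 1) ⊠ mk (X 1 0 2)) from (par_assoc _ _ _).trans (cast_id _ _ _),
      interchange, seq_id]
  rw [par_eq_seq_right (mk (X 2 1 0)) (mk (X 1 0 2)), par_empty, ← seq_assoc, h2, Z_pi_split_seq_par_X_effect_two, m4_p11, m4_p11,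
    m4_l221, m4_l221]

/-- Pushing the red `π/2` of `X^{(1,2)}(π/2)` down the last wire of the colour-swapped Lemma-34 diagram. [folklore] ((S1)) -/
theorem L34c_pushX2 (t u : ZMod 8) :
    (mk (Z 1 1 t) ⊠ mk (wires 1)) ⨟ (mk (X 1 3 0) ⊠ mk (X 1 2 2)) ⨟ (((mk (Z 1 0 1) ⊠ mk (wires 1)) ⊠ ((mk (Z 1 1 u) ⊠ mk (wires 1)) ⨟ mk cap)) ⊠ mk (wires 1)) ⨟ ((mk (Z 1 1 1) ⊠ mk (Z 1 1 2)) ⨟ mk (X 2 1 0)) = (mk (Z 1 1 t) ⊠ mk (wires 1)) ⨟ (mk (X 1 3 0) ⊠ mk (X 1 2 0)) ⨟ (((mk (Z 1 0 1) ⊠ mk (wires 1)) ⊠ ((mk (Z 1 1 u) ⊠ mk (wires 1)) ⨟ mk cap)) ⊠ mk (wires 1)) ⨟ (mk (Z 1 1 1) ⊠ (mk (X 1 1 2) ⨟ mk (Z 1 1 2))) ⨟ mk (X 2 1 0) := by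
  have hX : mk (X 1 2 2) = mk (X 1 2 0) ⨟ (mk (wires 1) ⊠ mk (X 1 1 2)) := by
    rw [X_seq_par_X 1 1 1 1 le_rfl, zero_add]
  have h1 : mk (X 1 3 0) ⊠ (mk (X 1 2 0) ⨟ (mk (wires 1) ⊠ mk (X 1 1 2))) = (mk (X 1 3 0) ⊠ mk (X 1 2 0)) ⨟ (mk (wires 4) ⊠ mk (X 1 1 2)) := by
    rw [show mk (X 1 3 0) ⊠ (mk (X 1 2 0) ⨟ (mk (wires 1) ⊠ mk (X 1 1 2))) = (mk (X 1 3 0) ⨟ mk (wires 3)) ⊠ (mk (X 1 2 0) ⨟ (mk (wires 1) ⊠ mk (X 1 1 2))) from by rw [seq_id],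
      ← interchange, show mk (wires 4) ⊠ mk (X 1 1 2) = mk (wires 3) ⊠ (mk (wires 1) ⊠ mk (X 1 1 2)) from by
      rw [← wires_par_wires 3 1]; exact (par_assoc _ _ _).trans (cast_id _ _ _)]
  have h2 : ∀ R : ZXClass 2 1, (mk (wires 4) ⊠ mk (X 1 1 2)) ⨟ ((((mk (Z 1 0 1) ⊠ mk (wires 1)) ⊠ ((mk (Z 1 1 u) ⊠ mk (wires 1)) ⨟ mk cap)) ⊠ mk (wires 1)) ⨟ R) = (((mk (Z 1 0 1) ⊠ mk (wires 1)) ⊠ ((mk (Z 1 1 u) ⊠ mk (wires 1)) ⨟ mk cap)) ⊠ mk (wires 1)) ⨟ ((mk (wires 1) ⊠ mk (X 1 1 2)) ⨟ R) := fun R => by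
    rw [← seq_assoc, ← seq_assoc, interchange, id_seq, seq_id, par_eq_seq_left ((mk (Z 1 0 1) ⊠ mk (wires 1)) ⊠ ((mk (Z 1 1 u) ⊠ mk (wires 1)) ⨟ mk cap)) (mk (X 1 1 2))]
  have h3 : (mk (wires 1) ⊠ mk (X 1 1 2)) ⨟ ((mk (Z 1 1 1) ⊠ mk (Z 1 1 2)) ⨟ mk (X 2 1 0)) = (mk (Z 1 1 1) ⊠ (mk (X 1 1 2) ⨟ mk (Z 1 1 2))) ⨟ mk (X 2 1 0) := by
    rw [← seq_assoc, interchange, id_seq]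
  rw [hX, h1]
  simp only [seq_assoc]
  rw [h2, h3]

/-- The Hadamard-free core of the Hadamard-branch block followed by `X(-π/2)` is the same common form. [folklore] ((S1)) -/
theorem L34t_seq_X (t u : ZMod 8) : ((mk (Z 1 1 t) ⊠ mk (wires 1)) ⨟ (mk (X 1 3 0) ⊠ mk (X 1 2 0)) ⨟ (((mk (Z 1 0 1) ⊠ mk (wires 1)) ⊠ ((mk (Z 1 1 u) ⊠ mk (wires 1)) ⨟ mk cap)) ⊠ (mk (X 1 1 2) ⨟ mk (Z 1 1 2) ⨟ mk (X 1 1 2))) ⨟ (mk (Z 1 1 1) ⊠ mk (wires 1)) ⨟ mk (X 2 1 0)) ⨟ mk (X 1 1 (-2)) = (mk (Z 1 1 t) ⊠ mk (wires 1)) ⨟ (mk (X 1 3 0) ⊠ mk (X 1 2 0)) ⨟ (((mk (Z 1 0 1) ⊠ mk (wires 1)) ⊠ ((mk (Z 1 1 u) ⊠ mk (wires 1)) ⨟ mk cap)) ⊠ mk (wires 1)) ⨟ (mk (Z 1 1 1) ⊠ (mk (X 1 1 2) ⨟ mk (Z 1 1 2))) ⨟ mk (X 2 1 0) := by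
  have h1 : ((mk (Z 1 0 1) ⊠ mk (wires 1)) ⊠ ((mk (Z 1 1 u) ⊠ mk (wires 1)) ⨟ mk cap)) ⊠ (mk (X 1 1 2) ⨟ mk (Z 1 1 2) ⨟ mk (X 1 1 2)) = (((mk (Z 1 0 1) ⊠ mk (wires 1)) ⊠ ((mk (Z 1 1 u) ⊠ mk (wires 1)) ⨟ mk cap)) ⊠ mk (wires 1)) ⨟ (mk (wires 1) ⊠ (mk (X 1 1 2) ⨟ mk (Z 1 1 2) ⨟ mk (X 1 1 2))) := par_eq_seq_left _ _
  have h2 : ∀ R : ZXClass 2 1, (mk (wires 1) ⊠ (mk (X 1 1 2) ⨟ (mk (Z 1 1 2) ⨟ mk (X 1 1 2)))) ⨟ ((mk (Z 1 1 1) ⊠ mk (wires 1)) ⨟ R) = (mk (Z 1 1 1) ⊠ (mk (X 1 1 2) ⨟ mk (Z 1 1 2))) ⨟ ((mk (wires 1) ⊠ mk (X 1 1 2)) ⨟ R) := fun R => by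
    rw [← seq_assoc (mk (wires 1) ⊠ (mk (X 1 1 2) ⨟ (mk (Z 1 1 2) ⨟ mk (X 1 1 2)))) (mk (Z 1 1 1) ⊠ mk (wires 1)) R, ← seq_assoc (mk (Z 1 1 1) ⊠ (mk (X 1 1 2) ⨟ mk (Z 1 1 2))) (mk (wires 1) ⊠ mk (X 1 1 2)) R,
      interchange, id_seq, seq_id, interchange, seq_id, seq_assoc (mk (X 1 1 2)) (mk (Z 1 1 2)) (mk (X 1 1 2))]
  have h3 : (mk (wires 1) ⊠ mk (X 1 1 2)) ⨟ (mk (X 2 1 0) ⨟ mk (X 1 1 (-2))) = mk (X 2 1 0) := by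
    rw [X_seq_X 2 1 1 le_rfl, par_X_seq_X 1 1 1 1 le_rfl, show (0 : ZMod 8) + -2 + 2 = 0 from by decide]
  rw [h1]
  simp only [seq_assoc]
  rw [h2, h3]

/-- **Lemma 34 colour-swapped, `G`-branch traded for the Euler core** (`α = π/4`, `β = π/2`): the block equals
`(1/√2)·Z_0(π/2) ⊗ (K̃ ⨾ X(-π/2))`. [cite: JeandelPerdrixVilmart2018, Appendix Lemma 34, Lemma (Euler decomposition), rules (S1), (K)] -/
theorem L34c_eq_core (t u : ZMod 8) : (mk (Z 1 1 t) ⊠ mk (wires 1)) ⨟ (mk (X 1 3 0) ⊠ mk (X 1 2 2)) ⨟ (((mk (Z 1 0 1) ⊠ mk (wires 1)) ⊠ ((mk (Z 1 1 u) ⊠ mk (wires 1)) ⨟ mk cap)) ⊠ mk (wires 1)) ⨟ (mk (Z 1 1 1) ⊠ mk (Z 1 2 4)) ⨟ (mk (X 2 1 0) ⊠ mk (X 1 0 2)) = mk invSqrtTwo ⊠ (mk (Z 0 0 2) ⊠ (((mk (Z 1 1 t) ⊠ mk (wires 1)) ⨟ (mk (X 1 3 0) ⊠ mk (X 1 2 0))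 ⨟ (((mk (Z 1 0 1) ⊠ mk (wires 1)) ⊠ ((mk (Z 1 1 u) ⊠ mk (wires 1)) ⨟ mk cap)) ⊠ (mk (X 1 1 2) ⨟ mk (Z 1 1 2) ⨟ mk (X 1 1 2))) ⨟ (mk (Z 1 1 1) ⊠ mk (wires 1)) ⨟ mk (X 2 1 0)) ⨟ mk (X 1 1 (-2)))) := by
  rw [L34t_seq_X, ← L34c_pushX2, seq_assoc _ (mk (Z 1 1 1) ⊠ mk (Z 1 2 4)) _, L34c_tail, m4_r221, m4_r221]


/-- Scalar mover (bookkeeping): `A ⨾ (s ⊗ B) = s ⊗ (A ⨾ B)` for `A : 5 → 2`, `B : 2 → 2`. [folklore] -/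
private theorem m4_r222' (A : ZXClass 5 2) (s : ZXClass 0 0) (B : ZXClass 2 2) : A ⨟ (s ⊠ B) = s ⊠ (A ⨟ B) := by
  rw [scalar_par_seq_right, empty_par, cast_id]

/-- Scalar mover (bookkeeping): `A ⨾ (s ⊗ B) = s ⊗ (A ⨾ B)` for `A : 2 → 5`, `B : 5 → 2`. [folklore] -/
private theorem seq_par_s (A : ZXClass 2 5) (s : ZXClass 0 0) (B : ZXClass 5 2) : A ⨟ (s ⊠ B) = s ⊠ (A ⨟ B) := by
  rw [scalar_par_seq_right, empty_par, cast_id]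

/-- Scalar mover (bookkeeping): `(s ⊗ A) ⨾ B = s ⊗ (A ⨾ B)` for `A : 2 → 2`, `B : 2 → 2`. [folklore] -/
private theorem m4_l2x (s : ZXClass 0 0) (A : ZXClass 2 2) (B : ZXClass 2 2) : (s ⊠ A) ⨟ B = s ⊠ (A ⨟ B) := by
  rw [scalar_par_seq_left, empty_par, cast_id]

/-- Scalar mover (bookkeeping): `(s ⊗ A) ⨾ B = s ⊗ (A ⨾ B)` for `A : 2 → 2`, `B : 2 → 1`. [folklore] -/
private theorem m4_l2y (s : ZXClass 0 0) (A : ZXClass 2 2) (B : ZXClass 2 1) : (s ⊠ A) ⨟ B = s ⊠ (A ⨟ B) := by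
  rw [scalar_par_seq_left, empty_par, cast_id]

/-- **The Hadamard-branch block equals `(1/√2)·Z_0(-π/2) ⊗ K̃`** (Euler decomposition of its Hadamard).
[cite: JeandelPerdrixVilmart2018, Lemma (Euler decomposition of H)] -/
theorem L34h_eq_core (t u : ZMod 8) : (mk (Z 1 1 t) ⊠ mk (wires 1)) ⨟ (mk (X 1 3 0) ⊠ mk (X 1 2 0)) ⨟ (((mk (Z 1 0 1) ⊠ mk (wires 1)) ⊠ ((mk (Z 1 1 u) ⊠ mk (wires 1)) ⨟ mk cap)) ⊠ mk hBox) ⨟ (mk (Z 1 1 1) ⊠ mk (wires 1)) ⨟ mk (X 2 1 0) = mk invSqrtTwo ⊠ (mk (Z 0 0 (-2)) ⊠ ((mk (Z 1 1 t) ⊠ mk (wires 1)) ⨟ (mk (X 1 3 0) ⊠ mk (X 1 2 0)) ⨟ (((mk (Z 1 0 1) ⊠ mk (wires 1)) ⊠ ((mk (Z 1 1 u) ⊠ mk (wires 1)) ⨟ mk cap)) ⊠ (mk (X 1 1 2) ⨟ mk (Z 1 1 2) ⨟ mk (X 1 1 2))) ⨟ (mk (Z 1 1 1) ⊠ mk (wires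 1)) ⨟ mk (X 2 1 0))) := by
  have h1 : ((mk (Z 1 0 1) ⊠ mk (wires 1)) ⊠ ((mk (Z 1 1 u) ⊠ mk (wires 1)) ⨟ mk cap)) ⊠ mk hBox = mk invSqrtTwo ⊠ (mk (Z 0 0 (-2)) ⊠ (((mk (Z 1 0 1) ⊠ mk (wires 1)) ⊠ ((mk (Z 1 1 u) ⊠ mk (wires 1)) ⨟ mk cap)) ⊠ (mk (X 1 1 2) ⨟ mk (Z 1 1 2) ⨟ mk (X 1 1 2)))) := by
    rw [hBox_eq_euler_red, par_eq_seq_left ((mk (Z 1 0 1) ⊠ mk (wires 1)) ⊠ ((mk (Z 1 1 u) ⊠ mk (wires 1)) ⨟ mk cap)) _, ← scalar_par_wires_par_one, ← scalar_par_wires_par_one, m4_r222', m4_r222', ← par_eq_seq_left]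
  rw [h1, seq_par_s, seq_par_s, m4_l2x, m4_l2x, m4_l2y, m4_l2y]

/-- Cancelling the scalar `(1/√2)·Z_0(π/2)` on `2 → 1` diagrams. [cite: JeandelPerdrixVilmart2018, Lemmas (inverse rule), (multiplying global phases)] -/
theorem cancel_invSqrtTwo_Zdot_two {A B : ZXClass 2 1} (h : mk invSqrtTwo ⊠ (mk (Z 0 0 2) ⊠ A) = mk invSqrtTwo ⊠ (mk (Z 0 0 2) ⊠ B)) : A = B := by
  have key : ∀ C : ZXClass 2 1, mk (dumbbell 4 (-1)) ⊠ (mk (dumbbell 0 0) ⊠ (mk invSqrtTwo ⊠ (mk (Z 0 0 2) ⊠ C))) = mk (dumbbell 0 0) ⊠ (mk (dumbbell 0 0) ⊠ C) := fun C => by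
    rw [Z_dot_two_eq, scalar_par_scalar_par (mk (dumbbell 4 (-1))) (mk (dumbbell 0 0)), scalar_par_scalar_par (mk (dumbbell 4 (-1))) (mk invSqrtTwo),
      show mk (dumbbell 4 (-1)) ⊠ (mk (dumbbell 4 1) ⊠ C) = (mk (dumbbell 4 (-1)) ⊠ mk (dumbbell 4 1)) ⊠ C from (par_assoc' _ _ _).trans (cast_id _ _ _),
      scalar_par_comm (mk (dumbbell 4 (-1))) (mk (dumbbell 4 1)), dumbbell_four_par_dumbbell_four_neg,
      show (mk (dumbbell 0 0) ⊠ mk (dumbbell 0 0)) ⊠ C = mk (dumbbell 0 0) ⊠ (mk (dumbbell 0 0) ⊠ C) from (par_assoc _ _ _).trans (cast_id _ _ _),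
      invSqrtTwo_par_sqrt_two_par_two_one]
  have h2 := congrArg (fun C => mk (dumbbell 4 (-1)) ⊠ (mk (dumbbell 0 0) ⊠ C)) h
  simp only [key] at h2
  have h3 := congrArg (fun C => mk invSqrtTwo ⊠ C) h2
  simp only [invSqrtTwo_par_sqrt_two_par_two_one] at h3
  have h4 := congrArg (fun C => mk invSqrtTwo ⊠ C) h3
  simpa only [invSqrtTwo_par_sqrt_two_par_two_one] using h4

/-- **Lemma 34 for the Euler-core block** `K̃`: `K̃(3π/4, −3π/4) = σ ⨾ K̃(−3π/4, 3π/4)`.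
[cite: JeandelPerdrixVilmart2018, Appendix Lemma 34 (colour-swapped, α = π/4, β = π/2, γ = −3π/4)] -/
theorem L34t : (mk (Z 1 1 3) ⊠ mk (wires 1)) ⨟ (mk (X 1 3 0) ⊠ mk (X 1 2 0)) ⨟ (((mk (Z 1 0 1) ⊠ mk (wires 1)) ⊠ ((mk (Z 1 1 (-3)) ⊠ mk (wires 1)) ⨟ mk cap)) ⊠ (mk (X 1 1 2) ⨟ mk (Z 1 1 2) ⨟ mk (X 1 1 2))) ⨟ (mk (Z 1 1 1) ⊠ mk (wires 1)) ⨟ mk (X 2 1 0) = mk swap ⨟ ((mk (Z 1 1 (-3)) ⊠ mk (wires 1)) ⨟ (mk (X 1 3 0) ⊠ mk (X 1 2 0)) ⨟ (((mk (Z 1 0 1) ⊠ mk (wires 1)) ⊠ ((mk (Z 1 1 3) ⊠ mk (wires 1)) ⨟ mk cap)) ⊠ (mk (X 1 1 2) ⨟ mk (Z 1 1 2) ⨟ mk (X 1 1 2))) ⨟ (mk (Z 1 1 1) ⊠ mk (wires 1)) ⨟ mk (X 2 1 0)) := by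
  have h := L34_colorSwap 1 2 (-3)
  simp only [neg_neg] at h
  rw [L34c_eq_core, L34c_eq_core, m4_r221, m4_r221] at h
  have h2 := congrArg (· ⨟ mk (X 1 1 2)) (cancel_invSqrtTwo_Zdot_two h)
  simpa only [seq_assoc, xphase_seq_xphase, show (-2 : ZMod 8) + 2 = 0 from by decide, X_one_one, seq_id] using h2

/-- **Lemma 34 in Hadamard-branch form**: `K_H(3π/4, −3π/4) = σ ⨾ K_H(−3π/4, 3π/4)`, `K_H(t,u)` the colour-swapped Lemma-34 block whose
`π`-node-with-red-leaf branch is replaced by a Hadamard edge into the final red node.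
[cite: JeandelPerdrixVilmart2018, Appendix Lemma 34, Lemma (Euler decomposition), proof of Lemma 35 steps (hd)] -/
theorem L34h : (mk (Z 1 1 3) ⊠ mk (wires 1)) ⨟ (mk (X 1 3 0) ⊠ mk (X 1 2 0)) ⨟ (((mk (Z 1 0 1) ⊠ mk (wires 1)) ⊠ ((mk (Z 1 1 (-3)) ⊠ mk (wires 1)) ⨟ mk cap)) ⊠ mk hBox) ⨟ (mk (Z 1 1 1) ⊠ mk (wires 1)) ⨟ mk (X 2 1 0) = mk swap ⨟ ((mk (Z 1 1 (-3)) ⊠ mk (wires 1)) ⨟ (mk (X 1 3 0) ⊠ mk (X 1 2 0)) ⨟ (((mk (Z 1 0 1) ⊠ mk (wires 1)) ⊠ ((mk (Z 1 1 3) ⊠ mk (wires 1)) ⨟ mk cap)) ⊠ mk hBox) ⨟ (mk (Z 1 1 1) ⊠ mk (wires 1)) ⨟ mk (X 2 1 0)) := by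
  rw [L34h_eq_core, L34h_eq_core, L34t, m4_r221, m4_r221]

/-- Regrouping (bookkeeping): `(A ⊗ 𝕀) ⊗ 𝕀 = A ⊗ 𝕀²` for `A : 1 → 1`. [folklore] -/
private theorem m4_rg11 (A : ZXClass 1 1) : (A ⊠ mk (wires 1)) ⊠ mk (wires 1) = A ⊠ mk (wires 2) := by
  rw [← wires_par_wires 1 1]; exact (par_assoc _ _ _).trans (cast_id _ _ _)

/-- Regrouping (bookkeeping): `(A ⊗ 𝕀) ⊗ 𝕀 = A ⊗ 𝕀²` for `A : 2 → 1`. [folklore] -/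
private theorem m4_rg21 (A : ZXClass 2 1) : (A ⊠ mk (wires 1)) ⊠ mk (wires 1) = A ⊠ mk (wires 2) := by
  rw [← wires_par_wires 1 1]; exact (par_assoc _ _ _).trans (cast_id _ _ _)

/-- A phase on the plain wire next to a cup can be taken out in front (bending bookkeeping). [folklore] (PROP axioms) -/
theorem wire_par_cup_seq_phase {n : ℕ} (t : ZMod 8) (R : ZXClass 3 n) :
    (mk (wires 1) ⊠ mk cup) ⨟ (((mk (Z 1 1 t) ⊠ mk (wires 1)) ⊠ mk (wires 1)) ⨟ R) = mk (Z 1 1 t) ⨟ ((mk (wires 1) ⊠ mk cup) ⨟ R) := by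
  have h : (mk (wires 1) ⊠ mk cup) ⨟ ((mk (Z 1 1 t) ⊠ mk (wires 1)) ⊠ mk (wires 1)) = mk (Z 1 1 t) ⨟ (mk (wires 1) ⊠ mk cup) := by
    rw [m4_rg11, interchange, id_seq, seq_id, show mk (Z 1 1 t) ⊠ mk cup = (mk (Z 1 1 t) ⨟ mk (wires 1)) ⊠ (mk (wires 0) ⨟ mk cup) from by rw [seq_id, id_seq],
      ← interchange, par_empty]
  rw [← seq_assoc, h, seq_assoc]

/-- The cup feeding the second input of the block: a red spider with a bent input (bending bookkeeping).
[folklore] (PROP axioms, (S) for red spiders) -/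
theorem wire_par_cup_seq_splits {n : ℕ} (R : ZXClass 6 n) :
    (mk (wires 1) ⊠ mk cup) ⨟ (((mk (X 1 3 0) ⊠ mk (X 1 2 0)) ⊠ mk (wires 1)) ⨟ R) = (mk (X 1 3 0) ⊠ (mk cup ⨟ (mk (wires 1) ⊠ mk (X 1 2 0)))) ⨟ R := by
  have h : (mk (wires 1) ⊠ mk cup) ⨟ ((mk (X 1 3 0) ⊠ mk (X 1 2 0)) ⊠ mk (wires 1)) = mk (X 1 3 0) ⊠ (mk cup ⨟ (mk (wires 1) ⊠ mk (X 1 2 0))) := by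
    rw [show (mk (X 1 3 0) ⊠ mk (X 1 2 0)) ⊠ mk (wires 1) = mk (X 1 3 0) ⊠ (mk (X 1 2 0) ⊠ mk (wires 1)) from (par_assoc _ _ _).trans (cast_id _ _ _), interchange, id_seq,
      ← X_zero_three_eq_cup_xsplit_par, X_zero_three_eq_cup_par_xsplit]
  rw [← seq_assoc, h]

/-- **Yanking the bridge**: the cup leg entering the red node of the bent block, capped against the bridge wire, is a plain
red split on the bridge wire: `(𝕀 ⊗ (∪ ⨾ (𝕀 ⊗ X^{(1,2)}))) ⨾ (((Z(u) ⊗ 𝕀) ⨾ ∩) ⊗ H ⊗ 𝕀) = Z(u) ⨾ X^{(1,2)} ⨾ (H ⊗ 𝕀)`.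
[folklore] (snake equation) -/
theorem bridge_yank (u : ZMod 8) :
    (mk (wires 1) ⊠ (mk cup ⨟ (mk (wires 1) ⊠ mk (X 1 2 0)))) ⨟ ((((mk (Z 1 1 u) ⊠ mk (wires 1)) ⨟ mk cap) ⊠ mk hBox) ⊠ mk (wires 1)) = mk (Z 1 1 u) ⨟ mk (X 1 2 0) ⨟ (mk hBox ⊠ mk (wires 1)) := by
  rw [wires_par_seq, show (((mk (Z 1 1 u) ⊠ mk (wires 1)) ⨟ mk cap) ⊠ mk hBox) ⊠ mk (wires 1) = ((mk (Z 1 1 u) ⊠ mk (wires 1)) ⨟ mk cap) ⊠ (mk hBox ⊠ mk (wires 1)) from (par_assoc _ _ _).trans (cast_id _ _ _),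
    show mk (wires 1) ⊠ (mk (wires 1) ⊠ mk (X 1 2 0)) = mk (wires 2) ⊠ mk (X 1 2 0) from by rw [← wires_par_wires 1 1]; exact (par_assoc' _ _ _).trans (cast_id _ _ _),
    seq_assoc, interchange, id_seq, par_eq_seq_left ((mk (Z 1 1 u) ⊠ mk (wires 1)) ⨟ mk cap) (mk (X 1 2 0) ⨟ (mk hBox ⊠ mk (wires 1))), empty_par, cast_id,
    ← seq_assoc, seq_par_wires, wire_par_cup_seq_phase, snake_left, seq_id, seq_assoc]

/-- The third layer of the bent block regrouped around the yanked bridge. [folklore] (PROP axioms, snake equation) -/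
theorem splits_par_bentCup_seq_layer (u : ZMod 8) :
    (mk (X 1 3 0) ⊠ (mk cup ⨟ (mk (wires 1) ⊠ mk (X 1 2 0)))) ⨟ ((((mk (Z 1 0 1) ⊠ mk (wires 1)) ⊠ ((mk (Z 1 1 u) ⊠ mk (wires 1)) ⨟ mk cap)) ⊠ mk hBox) ⊠ mk (wires 1)) = mk (X 1 3 0) ⨟ ((mk (Z 1 0 1) ⊠ mk (wires 1)) ⊠ (mk (Z 1 1 u) ⨟ mk (X 1 2 0) ⨟ (mk hBox ⊠ mk (wires 1)))) := by
  rw [show mk (X 1 3 0) ⊠ (mk cup ⨟ (mk (wires 1) ⊠ mk (X 1 2 0))) = (mk (X 1 3 0) ⨟ mk (wires 3)) ⊠ (mk (wires 0) ⨟ (mk cup ⨟ (mk (wires 1) ⊠ mk (X 1 2 0)))) from by rw [seq_id, id_seq],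
    ← interchange, par_empty,
    show (((mk (Z 1 0 1) ⊠ mk (wires 1)) ⊠ ((mk (Z 1 1 u) ⊠ mk (wires 1)) ⨟ mk cap)) ⊠ mk hBox) ⊠ mk (wires 1) = (mk (Z 1 0 1) ⊠ mk (wires 1)) ⊠ (((((mk (Z 1 1 u) ⊠ mk (wires 1)) ⨟ mk cap) ⊠ mk hBox) ⊠ mk (wires 1))) from by
      rw [show ((mk (Z 1 0 1) ⊠ mk (wires 1)) ⊠ ((mk (Z 1 1 u) ⊠ mk (wires 1)) ⨟ mk cap)) ⊠ mk hBox = (mk (Z 1 0 1) ⊠ mk (wires 1)) ⊠ (((mk (Z 1 1 u) ⊠ mk (wires 1)) ⨟ mk cap) ⊠ mk hBox) from (par_assoc _ _ _).trans (cast_id _ _ _)]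
      exact (par_assoc _ _ _).trans (cast_id _ _ _),
    show mk (wires 3) ⊠ (mk cup ⨟ (mk (wires 1) ⊠ mk (X 1 2 0))) = mk (wires 2) ⊠ (mk (wires 1) ⊠ (mk cup ⨟ (mk (wires 1) ⊠ mk (X 1 2 0)))) from by rw [← wires_par_wires 2 1]; exact (par_assoc _ _ _).trans (cast_id _ _ _),
    seq_assoc, interchange, id_seq, bridge_yank]

/-- Tail bookkeeping for the bent block: the `π/4` phase layer passes the yanked bridge block. [folklore] (PROP axioms) -/
theorem leaf_layer_comm {n : ℕ} (T' : ZXClass 1 2) (R : ZXClass 3 n) :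
    ((mk (Z 1 0 1) ⊠ mk (wires 1)) ⊠ T') ⨟ (((mk (Z 1 1 1) ⊠ mk (wires 1)) ⊠ mk (wires 1)) ⨟ R) = ((mk (Z 1 0 1) ⊠ mk (wires 1)) ⊠ mk (wires 1)) ⨟ ((mk (Z 1 1 1) ⊠ T') ⨟ R) := by
  rw [← seq_assoc, ← seq_assoc, m4_rg11, interchange, seq_id, interchange, id_seq]

/-- Tail bookkeeping for the bent block: the gadget on the free cup leg is moved before the merge of the block's output.
[folklore] (PROP axioms) -/
theorem block_par_seq_merge_par_seq_wire_par {n : ℕ} (T' G' : ZXClass 1 2) (R : ZXClass 3 n) :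
    (mk (Z 1 1 1) ⊠ T') ⨟ ((mk (X 2 1 0) ⊠ mk (wires 1)) ⨟ ((mk (wires 1) ⊠ G') ⨟ R)) = (mk (Z 1 1 1) ⊠ (T' ⨟ (mk (wires 1) ⊠ G'))) ⨟ (((mk (X 2 1 0) ⊠ mk (wires 1)) ⊠ mk (wires 1)) ⨟ R) := by
  have e1 : (mk (X 2 1 0) ⊠ mk (wires 1)) ⨟ (mk (wires 1) ⊠ G') = (mk (wires 2) ⊠ G') ⨟ ((mk (X 2 1 0) ⊠ mk (wires 1)) ⊠ mk (wires 1)) := by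
    rw [interchange, seq_id, id_seq, m4_rg21, interchange, id_seq, seq_id]
  have e2 : (mk (Z 1 1 1) ⊠ T') ⨟ (mk (wires 2) ⊠ G') = mk (Z 1 1 1) ⊠ (T' ⨟ (mk (wires 1) ⊠ G')) := by
    rw [← wires_par_wires 1 1, show (mk (wires 1) ⊠ mk (wires 1)) ⊠ G' = mk (wires 1) ⊠ (mk (wires 1) ⊠ G') from (par_assoc _ _ _).trans (cast_id _ _ _), interchange, seq_id]
  rw [← seq_assoc (mk (X 2 1 0) ⊠ mk (wires 1)) (mk (wires 1) ⊠ G') R, e1, seq_assoc (mk (wires 2) ⊠ G') _ R, ← seq_assoc (mk (Z 1 1 1) ⊠ T') (mk (wires 2) ⊠ G') _, e2]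

/-- Tail bookkeeping for the bent block: the gadget enters the yanked bridge block. [folklore] (PROP axioms) -/
theorem bridgeBlock_seq_wire_par (u : ZMod 8) (G' : ZXClass 1 2) :
    (mk (Z 1 1 u) ⨟ mk (X 1 2 0) ⨟ (mk hBox ⊠ mk (wires 1))) ⨟ (mk (wires 1) ⊠ G') = mk (Z 1 1 u) ⨟ (mk (X 1 2 0) ⨟ (mk hBox ⊠ G')) := by
  rw [seq_assoc, interchange, seq_id, id_seq, seq_assoc]

/-- **Bending the Hadamard-branch block by its second input** (`Y_R`): feeding the second input of `K_H(−3π/4, 3π/4)` from a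
cup and closing with the final merge/gadget gives the right spine form of the Lemma-35 chain. [folklore] (snake equation, (S)) -/
theorem Y_R : (mk (wires 1) ⊠ mk cup) ⨟ (((mk (Z 1 1 (-3)) ⊠ mk (wires 1)) ⨟ (mk (X 1 3 0) ⊠ mk (X 1 2 0)) ⨟ (((mk (Z 1 0 1) ⊠ mk (wires 1)) ⊠ ((mk (Z 1 1 3) ⊠ mk (wires 1)) ⨟ mk cap)) ⊠ mk hBox) ⨟ (mk (Z 1 1 1) ⊠ mk (wires 1)) ⨟ mk (X 2 1 0)) ⊠ mk (wires 1)) ⨟ ((mk (wires 1) ⊠ (mk (Z 1 2 (-2)) ⨟ (mk (wires 1) ⊠ mk (X 1 1 2)))) ⨟ (mk (X 2 1 0) ⊠ mk (wires 1))) = mk (Z 1 1 (-3)) ⨟ mk (X 1 3 0) ⨟ ((mk (Z 1 0 1) ⊠ mk (wires 1)) ⊠ mk (wires 1)) ⨟ ((mk (Z 1 1 1) ⊠ (mk (Z 1 1 3) ⨟ mk (X 1 2 0) ⨟ (mk hBox ⊠ (mk (Z 1 2 (-2)) ⨟ (mk (wires 1) ⊠ mk (X 1 1 2)))))) ⨟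 ((mk (X 2 1 0) ⊠ mk (wires 1)) ⊠ mk (wires 1)) ⨟ (mk (X 2 1 0) ⊠ mk (wires 1))) := by
  simp only [seq_par_wires, seq_assoc]
  rw [wire_par_cup_seq_phase, wire_par_cup_seq_splits, ← seq_assoc (mk (X 1 3 0) ⊠ (mk cup ⨟ (mk (wires 1) ⊠ mk (X 1 2 0)))) ((((mk (Z 1 0 1) ⊠ mk (wires 1)) ⊠ ((mk (Z 1 1 3) ⊠ mk (wires 1)) ⨟ mk cap)) ⊠ mk hBox) ⊠ mk (wires 1)) _, splits_par_bentCup_seq_layer,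
    seq_assoc (mk (X 1 3 0)) _ _, leaf_layer_comm, block_par_seq_merge_par_seq_wire_par, bridgeBlock_seq_wire_par]

/-- Regrouping (bookkeeping): `(A ⊗ 𝕀) ⊗ 𝕀 = A ⊗ 𝕀²` for `A : 1 → 3`. [folklore] -/
private theorem m4_rg13x (A : ZXClass 1 3) : (A ⊠ mk (wires 1)) ⊠ mk (wires 1) = A ⊠ mk (wires 2) := by
  rw [← wires_par_wires 1 1]; exact (par_assoc _ _ _).trans (cast_id _ _ _)

/-- Regrouping (bookkeeping): `(A ⊗ 𝕀) ⊗ 𝕀 = A ⊗ 𝕀²` for `A : 2 → 2`. [folklore] -/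
private theorem m4_rg22 (A : ZXClass 2 2) : (A ⊠ mk (wires 1)) ⊠ mk (wires 1) = A ⊠ mk (wires 2) := by
  rw [← wires_par_wires 1 1]; exact (par_assoc _ _ _).trans (cast_id _ _ _)

/-- Red spider law: a red split on the first wire followed by a red merge with the second wire is the `2 → 2` red spider.
[cite: JeandelPerdrixVilmart2018, rule (S1) (colour-swapped)] -/
theorem xsplit_par_seq_par_xmerge : (mk (X 1 2 0) ⊠ mk (wires 1)) ⨟ (mk (wires 1) ⊠ mk (X 2 1 0)) = mk (X 2 2 0) := by
  have hZ : (mk (Z 1 2 0) ⊠ mk (wires 1)) ⨟ (mk (wires 1) ⊠ mk (Z 2 1 0)) = mk (Z 2 2 0) := by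
    have h := fusion 1 1 1 1 1 le_rfl (0 : ZMod 8) 0
    rw [ofEq_id, seq_id, add_zero] at h
    exact h
  rw [← colorSwap_inj]
  simp only [colorSwap_seq, colorSwap_par, colorSwap_mk, ZXDiagram.colorSwap_X, ZXDiagram.colorSwap_wires]
  exact hZ

/-- Red spider law: `X^{(2,2)} = X^{(2,1)} ⨾ X^{(1,2)}`. [cite: JeandelPerdrixVilmart2018, rule (S1)] -/
theorem X_two_two_eq : mk (X 2 2 0) = mk (X 2 1 0) ⨟ mk (X 1 2 0) := by
  rw [X_seq_X 2 1 2 le_rfl, add_zero]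

/-- Bending the last output of `X^{(1,3)}` into an input with a cap gives `X^{(2,2)}`. [cite: JeandelPerdrixVilmart2018, rule (S1); compact structure] -/
theorem xsplit3_par_seq_cap : (mk (X 1 3 0) ⊠ mk (wires 1)) ⨟ (mk (wires 2) ⊠ mk cap) = mk (X 2 2 0) := by
  rw [show mk (X 1 3 0) = mk (X 1 2 0) ⨟ (mk (wires 1) ⊠ mk (X 1 2 0)) from by rw [X_seq_par_X 1 1 1 2 le_rfl, add_zero], seq_par_wires, seq_assoc,
    show (mk (wires 1) ⊠ mk (X 1 2 0)) ⊠ mk (wires 1) = mk (wires 1) ⊠ (mk (X 1 2 0) ⊠ mk (wires 1)) from (par_assoc _ _ _).trans (cast_id _ _ _),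
    ← wires_par_wires 1 1, show (mk (wires 1) ⊠ mk (wires 1)) ⊠ mk cap = mk (wires 1) ⊠ (mk (wires 1) ⊠ mk cap) from (par_assoc _ _ _).trans (cast_id _ _ _),
    ← wires_par_seq, xsplit_par_seq_par_cap, xsplit_par_seq_par_xmerge]

/-- The `2 → 2` red spider presented as split-first with the passing wire crossing: `(X^{(1,2)} ⊗ 𝕀) ⨾ (𝕀 ⊗ σ) ⨾ (X^{(2,1)} ⊗ 𝕀) = X^{(2,1)} ⨾ X^{(1,2)}`.
[cite: JeandelPerdrixVilmart2018, rule (S1); PROP axioms] -/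
theorem xsplit_swap_xmerge : (mk (X 1 2 0) ⊠ mk (wires 1)) ⨟ (mk (wires 1) ⊠ mk swap) ⨟ (mk (X 2 1 0) ⊠ mk (wires 1)) = mk (X 2 1 0) ⨟ mk (X 1 2 0) := by
  rw [show mk (X 1 2 0) ⊠ mk (wires 1) = (mk (X 1 2 0) ⨟ mk swap) ⊠ mk (wires 1) from by rw [X_seq_swap], seq_par_wires, seq_assoc (mk (X 1 2 0) ⊠ mk (wires 1)),
    ← fswap1_two, seq_assoc, fswap1_nat, fswap1_one, ← seq_assoc, xsplit_par_seq_par_xmerge, X_seq_swap, X_two_two_eq]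

/-- **The cap of the bridge bends the red node**: in `K_H` with its first layer removed, the red `X^{(1,3)}` whose last leg is
capped against the bridge wire is the `2 → 2` red spider fed by the bridge.
[cite: JeandelPerdrixVilmart2018, rule (S1); compact structure] -/
theorem splits_seq_bridgeLayer (u : ZMod 8) :
    (mk (X 1 3 0) ⊠ mk (X 1 2 0)) ⨟ (((mk (Z 1 0 1) ⊠ mk (wires 1)) ⊠ ((mk (Z 1 1 u) ⊠ mk (wires 1)) ⨟ mk cap)) ⊠ mk hBox) =
      (mk (wires 1) ⊠ (mk (X 1 2 0) ⨟ (mk (Z 1 1 u) ⊠ mk hBox))) ⨟ (mk (X 2 2 0) ⊠ mk (wires 1)) ⨟ ((mk (Z 1 0 1) ⊠ mk (wires 1)) ⊠ mk (wires 1)) := by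
  have hL : ((mk (Z 1 0 1) ⊠ mk (wires 1)) ⊠ ((mk (Z 1 1 u) ⊠ mk (wires 1)) ⨟ mk cap)) ⊠ mk hBox =
      (mk (wires 3) ⊠ (mk (Z 1 1 u) ⊠ mk hBox)) ⨟ (((mk (wires 2) ⊠ mk cap) ⊠ mk (wires 1)) ⨟ ((mk (Z 1 0 1) ⊠ mk (wires 1)) ⊠ mk (wires 1))) := by
    rw [phase_par_seq_cap, ← par_phase_seq_cap, show (mk (Z 1 0 1) ⊠ mk (wires 1)) ⊠ ((mk (wires 1) ⊠ mk (Z 1 1 u)) ⨟ mk cap) = (mk (wires 2) ⨟ (mk (Z 1 0 1) ⊠ mk (wires 1))) ⊠ ((mk (wires 1) ⊠ mk (Z 1 1 u)) ⨟ mk cap) from by rw [id_seq],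
      ← interchange, show ((mk (wires 2) ⊠ (mk (wires 1) ⊠ mk (Z 1 1 u))) ⨟ ((mk (Z 1 0 1) ⊠ mk (wires 1)) ⊠ mk cap)) ⊠ mk hBox = ((mk (wires 2) ⊠ (mk (wires 1) ⊠ mk (Z 1 1 u))) ⨟ ((mk (Z 1 0 1) ⊠ mk (wires 1)) ⊠ mk cap)) ⊠ (mk hBox ⨟ mk (wires 1)) from by rw [seq_id],
      ← interchange, par_eq_seq_right (mk (Z 1 0 1) ⊠ mk (wires 1)) (mk cap), par_empty, seq_par_wires,
      show mk (wires 2) ⊠ (mk (wires 1) ⊠ mk (Z 1 1 u)) = mk (wires 3) ⊠ mk (Z 1 1 u) from by rw [← wires_par_wires 2 1]; exact (par_assoc' _ _ _).trans (cast_id _ _ _),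
      show (mk (wires 3) ⊠ mk (Z 1 1 u)) ⊠ mk hBox = mk (wires 3) ⊠ (mk (Z 1 1 u) ⊠ mk hBox) from (par_assoc _ _ _).trans (cast_id _ _ _)]
  rw [hL, ← seq_assoc, show mk (X 1 3 0) ⊠ mk (X 1 2 0) = (mk (X 1 3 0) ⨟ mk (wires 3)) ⊠ mk (X 1 2 0) from by rw [seq_id], interchange, seq_id, seq_id,
    par_eq_seq_right (mk (X 1 3 0)) (mk (X 1 2 0) ⨟ (mk (Z 1 1 u) ⊠ mk hBox)), seq_assoc, ← seq_assoc (mk (X 1 3 0) ⊠ mk (wires 2)),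
    ← m4_rg13x, ← seq_par_wires, xsplit3_par_seq_cap, ← seq_assoc]

/-- **The cup bends the red node** (three wires): `(∪ ⊗ 𝕀) ⨾ (𝕀 ⊗ σ) ⨾ (X^{(2,2)} ⊗ 𝕀) = X^{(1,3)}`.
[cite: JeandelPerdrixVilmart2018, rule (S1); compact structure] -/
theorem cup_swap_xspider : (mk cup ⊠ mk (wires 1)) ⨟ (mk (wires 1) ⊠ mk swap) ⨟ (mk (X 2 2 0) ⊠ mk (wires 1)) = mk (X 1 3 0) := by
  have hX13 : mk (X 1 3 0) ⨟ (mk swap ⊠ mk (wires 1)) = mk (X 1 3 0) := by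
    rw [← hbb_xsplit_seq_xsplit_par, seq_assoc, ← seq_par_wires, X_seq_swap]
  rw [show mk cup ⊠ mk (wires 1) = (mk cup ⊠ mk (wires 1)) ⨟ (mk swap ⊠ mk (wires 1)) from by rw [← seq_par_wires, cup_swap], seq_assoc (mk cup ⊠ mk (wires 1)) (mk swap ⊠ mk (wires 1)) (mk (wires 1) ⊠ mk swap),
    ← fswap1_two, seq_assoc, fswap1_nat, ← seq_assoc, X_two_two_eq, wires_par_seq, ← seq_assoc, xspider_bend, X_seq_par_X 1 1 1 2 le_rfl,
    add_zero, fswap1_two, ← seq_assoc, hX13, hbb_X_one_three_seq_par_swap]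

/-- **The cup bends the red node** (four wires, the Hadamard wire routed past the free cup leg).
[cite: JeandelPerdrixVilmart2018, rule (S1); compact structure, PROP axioms] -/
theorem cup_fswap_xspider : (mk cup ⊠ mk (wires 2)) ⨟ (mk (wires 1) ⊠ mk (fswap1 2)) ⨟ ((mk (X 2 2 0) ⊠ mk (wires 1)) ⊠ mk (wires 1)) = (mk (X 1 3 0) ⊠ mk (wires 1)) ⨟ (mk (wires 2) ⊠ mk swap) := by
  have hc : (mk (wires 2) ⊠ mk swap) ⨟ (mk (X 2 2 0) ⊠ mk (wires 2)) = (mk (X 2 2 0) ⊠ mk (wires 2)) ⨟ (mk (wires 2) ⊠ mk swap) := by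
    rw [interchange, id_seq, seq_id, interchange, id_seq, seq_id]
  rw [fswap1_two, wires_par_seq, show mk (wires 1) ⊠ (mk swap ⊠ mk (wires 1)) = (mk (wires 1) ⊠ mk swap) ⊠ mk (wires 1) from (par_assoc' _ _ _).trans (cast_id _ _ _),
    show mk (wires 1) ⊠ (mk (wires 1) ⊠ mk swap) = mk (wires 2) ⊠ mk swap from by rw [← wires_par_wires 1 1]; exact (par_assoc' _ _ _).trans (cast_id _ _ _),
    m4_rg22, seq_assoc, seq_assoc, hc, ← seq_assoc, ← seq_assoc, show mk cup ⊠ mk (wires 2) = (mk cup ⊠ mk (wires 1)) ⊠ mk (wires 1) from by rw [← wires_par_wires 1 1]; exact (par_assoc' _ _ _).trans (cast_id _ _ _),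
    ← m4_rg22, ← seq_par_wires, ← seq_par_wires, cup_swap_xspider]

/-- A phase on the first of three wires commutes with the swap of the other two (bookkeeping). [folklore] (PROP axioms) -/
theorem swap_par_seq_phase_par_par {n : ℕ} (t : ZMod 8) (R : ZXClass 3 n) :
    (mk swap ⊠ mk (wires 1)) ⨟ (((mk (Z 1 1 t) ⊠ mk (wires 1)) ⊠ mk (wires 1)) ⨟ R) = ((mk (wires 1) ⊠ mk (Z 1 1 t)) ⊠ mk (wires 1)) ⨟ ((mk swap ⊠ mk (wires 1)) ⨟ R) := by
  rw [← seq_assoc, ← seq_assoc, ← seq_par_wires, swap_seq_par_one_one, seq_par_wires]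

/-- A phase on a leg of a cup slides to the other leg (bookkeeping, four-wire context). [folklore] (compact structure) -/
theorem wire_par_cup_seq_wire_par_phase {n : ℕ} (t : ZMod 8) (R : ZXClass 3 n) :
    (mk (wires 1) ⊠ mk cup) ⨟ (((mk (wires 1) ⊠ mk (Z 1 1 t)) ⊠ mk (wires 1)) ⨟ R) = (mk (wires 1) ⊠ mk cup) ⨟ ((mk (wires 2) ⊠ mk (Z 1 1 t)) ⨟ R) := by
  have h : (mk (wires 1) ⊠ mk cup) ⨟ ((mk (wires 1) ⊠ mk (Z 1 1 t)) ⊠ mk (wires 1)) = (mk (wires 1) ⊠ mk cup) ⨟ (mk (wires 2) ⊠ mk (Z 1 1 t)) := by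
    rw [show (mk (wires 1) ⊠ mk (Z 1 1 t)) ⊠ mk (wires 1) = mk (wires 1) ⊠ (mk (Z 1 1 t) ⊠ mk (wires 1)) from (par_assoc _ _ _).trans (cast_id _ _ _), ← wires_par_seq, cup_seq_phase_par,
      ← cup_seq_par_phase, wires_par_seq, show mk (wires 1) ⊠ (mk (wires 1) ⊠ mk (Z 1 1 t)) = mk (wires 2) ⊠ mk (Z 1 1 t) from by rw [← wires_par_wires 1 1]; exact (par_assoc' _ _ _).trans (cast_id _ _ _)]
  rw [← seq_assoc, h, seq_assoc]

/-- A phase on the last wire commutes with a block on the other wires (bookkeeping). [folklore] (PROP axioms) -/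
theorem wires_par_phase_seq_par_wire {n m k : ℕ} (c : ZMod 8) (A : ZXClass n m) (R : ZXClass (m + 1) k) :
    (mk (wires n) ⊠ mk (Z 1 1 c)) ⨟ ((A ⊠ mk (wires 1)) ⨟ R) = (A ⊠ mk (wires 1)) ⨟ ((mk (wires m) ⊠ mk (Z 1 1 c)) ⨟ R) := by
  rw [← seq_assoc, ← seq_assoc, interchange, id_seq, seq_id, interchange, seq_id, id_seq]

/-- The relocated phase fuses into the gadget of the free cup leg. [cite: JeandelPerdrixVilmart2018, rule (S1)] -/
theorem wire_par_phase_seq_wire_par_gadget {n : ℕ} (R : ZXClass 3 n) :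
    (mk (wires 1) ⊠ mk (Z 1 1 3)) ⨟ ((mk (wires 1) ⊠ (mk (Z 1 2 (-2)) ⨟ (mk (wires 1) ⊠ mk (X 1 1 2)))) ⨟ R) = (mk (wires 1) ⊠ (mk (Z 1 2 1) ⨟ (mk (wires 1) ⊠ mk (X 1 1 2)))) ⨟ R := by
  rw [← seq_assoc, ← wires_par_seq, ← seq_assoc (mk (Z 1 1 3)) (mk (Z 1 2 (-2))) _, Z_seq_Z 1 1 2 le_rfl, show (3 : ZMod 8) + -2 = 1 from by decide]

/-- **`Y_L`, stage 1**: the phase `Z(3π/4)` on the first input of `K_H` slides around the cup, past the block, and fuses into the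
gadget of the free cup leg. [folklore] (compact structure, (S1)) -/
theorem Y_L_stage1 : (mk (wires 1) ⊠ mk cup) ⨟ (mk swap ⊠ mk (wires 1)) ⨟ (((mk (Z 1 1 3) ⊠ mk (wires 1)) ⨟ (mk (X 1 3 0) ⊠ mk (X 1 2 0)) ⨟ (((mk (Z 1 0 1) ⊠ mk (wires 1)) ⊠ ((mk (Z 1 1 (-3)) ⊠ mk (wires 1)) ⨟ mk cap)) ⊠ mk hBox) ⨟ (mk (Z 1 1 1) ⊠ mk (wires 1)) ⨟ mk (X 2 1 0)) ⊠ mk (wires 1)) ⨟ ((mk (wires 1) ⊠ (mk (Z 1 2 (-2)) ⨟ (mk (wires 1) ⊠ mk (X 1 1 2)))) ⨟ (mk (X 2 1 0) ⊠ mk (wires 1))) = (mk (wires 1) ⊠ mk cup) ⨟ (mk swap ⊠ mk (wires 1)) ⨟ (((mk (X 1 3 0) ⊠ mk (X 1 2 0)) ⨟ (((mk (Z 1 0 1) ⊠ mk (wires 1)) ⊠ ((mk (Z 1 1 (-3)) ⊠ mk (wires 1)) ⨟ mk cap)) ⊠ mk hBox) ⨟ (mk (Z 1 1 1) ⊠ mk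 (wires 1)) ⨟ mk (X 2 1 0)) ⊠ mk (wires 1)) ⨟ ((mk (wires 1) ⊠ (mk (Z 1 2 1) ⨟ (mk (wires 1) ⊠ mk (X 1 1 2)))) ⨟ (mk (X 2 1 0) ⊠ mk (wires 1))) := by
  simp only [seq_par_wires, seq_assoc]
  rw [swap_par_seq_phase_par_par, wire_par_cup_seq_wire_par_phase, wires_par_phase_seq_par_wire 3 (mk swap), wires_par_phase_seq_par_wire,
    wires_par_phase_seq_par_wire, wires_par_phase_seq_par_wire, wires_par_phase_seq_par_wire, wire_par_phase_seq_wire_par_gadget]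

/-- Regrouping (bookkeeping): `(A ⊗ 𝕀) ⊗ 𝕀 = A ⊗ 𝕀²` for `A : 1 → 2`. [folklore] -/
private theorem m4_rg12x (A : ZXClass 1 2) : (A ⊠ mk (wires 1)) ⊠ mk (wires 1) = A ⊠ mk (wires 2) := by
  rw [← wires_par_wires 1 1]; exact (par_assoc _ _ _).trans (cast_id _ _ _)

/-- Routing the second input past a `1 → 2` block on the first wire (bookkeeping). [folklore] (PROP axioms) -/
theorem wire_par_swap_seq_wire_par_block_par {n : ℕ} (Q : ZXClass 1 2) (R : ZXClass 4 n) :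
    (mk (wires 1) ⊠ mk swap) ⨟ (((mk (wires 1) ⊠ Q) ⊠ mk (wires 1)) ⨟ R) = (mk (wires 2) ⊠ Q) ⨟ ((mk (wires 1) ⊠ mk (fswap1 2)) ⨟ R) := by
  have h : (mk (wires 1) ⊠ mk swap) ⨟ ((mk (wires 1) ⊠ Q) ⊠ mk (wires 1)) = (mk (wires 2) ⊠ Q) ⨟ (mk (wires 1) ⊠ mk (fswap1 2)) := by
    rw [show (mk (wires 1) ⊠ Q) ⊠ mk (wires 1) = mk (wires 1) ⊠ (Q ⊠ mk (wires 1)) from (par_assoc _ _ _).trans (cast_id _ _ _), ← wires_par_seq, ← fswap1_one, fswap1_nat, wires_par_seq,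
      show mk (wires 1) ⊠ (mk (wires 1) ⊠ Q) = mk (wires 2) ⊠ Q from by rw [← wires_par_wires 1 1]; exact (par_assoc' _ _ _).trans (cast_id _ _ _)]
  rw [← seq_assoc, h, seq_assoc]

/-- The cup passes a `1 → 2` block on the input wire (bookkeeping). [folklore] (PROP axioms) -/
theorem cup_par_seq_wires_par_block {n : ℕ} (Q : ZXClass 1 2) (R : ZXClass 4 n) :
    (mk cup ⊠ mk (wires 1)) ⨟ ((mk (wires 2) ⊠ Q) ⨟ R) = Q ⨟ ((mk cup ⊠ mk (wires 2)) ⨟ R) := by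
  have h : (mk cup ⊠ mk (wires 1)) ⨟ (mk (wires 2) ⊠ Q) = Q ⨟ (mk cup ⊠ mk (wires 2)) := by
    rw [interchange, seq_id, id_seq, show mk cup ⊠ Q = (mk (wires 0) ⨟ mk cup) ⊠ (Q ⨟ mk (wires 2)) from by rw [id_seq, seq_id], ← interchange, empty_par, cast_id]
  rw [← seq_assoc, h, seq_assoc]

/-- The cup bends the red node (four wires), continuation form. [cite: JeandelPerdrixVilmart2018, rule (S1); compact structure] -/
theorem cup_fswap_xspider_cps {n : ℕ} (R : ZXClass 4 n) :
    (mk cup ⊠ mk (wires 2)) ⨟ ((mk (wires 1) ⊠ mk (fswap1 2)) ⨟ (((mk (X 2 2 0) ⊠ mk (wires 1)) ⊠ mk (wires 1)) ⨟ R)) = (mk (X 1 3 0) ⊠ mk (wires 1)) ⨟ ((mk (wires 2) ⊠ mk swap) ⨟ R) := by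
  rw [← seq_assoc, ← seq_assoc, cup_fswap_xspider, seq_assoc]

/-- **`Y_L`, stage 2**: the cap of the bridge and the cup bend the red node of the block; the result is cup-free.
[cite: JeandelPerdrixVilmart2018, rule (S1); compact structure] -/
theorem Y_L_stage2 : (mk (wires 1) ⊠ mk cup) ⨟ (mk swap ⊠ mk (wires 1)) ⨟ (((mk (X 1 3 0) ⊠ mk (X 1 2 0)) ⨟ (((mk (Z 1 0 1) ⊠ mk (wires 1)) ⊠ ((mk (Z 1 1 (-3)) ⊠ mk (wires 1)) ⨟ mk cap)) ⊠ mk hBox) ⨟ (mk (Z 1 1 1) ⊠ mk (wires 1)) ⨟ mk (X 2 1 0)) ⊠ mk (wires 1)) ⨟ ((mk (wires 1) ⊠ (mk (Z 1 2 1) ⨟ (mk (wires 1) ⊠ mk (X 1 1 2)))) ⨟ (mk (X 2 1 0) ⊠ mk (wires 1))) = mk (X 1 2 0) ⨟ (mk (Z 1 1 (-3)) ⊠ mk hBox) ⨟ (mk (X 1 3 0) ⊠ mk (wires 1)) ⨟ (mk (wires 2) ⊠ mk swap) ⨟ (((mk (Z 1 0 1) ⊠ mk (wires 1)) ⊠ mk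 (wires 1)) ⊠ mk (wires 1)) ⨟ ((mk (Z 1 1 1) ⊠ mk (wires 1)) ⊠ mk (wires 1)) ⨟ (mk (X 2 1 0) ⊠ mk (wires 1)) ⨟ ((mk (wires 1) ⊠ (mk (Z 1 2 1) ⨟ (mk (wires 1) ⊠ mk (X 1 1 2)))) ⨟ (mk (X 2 1 0) ⊠ mk (wires 1))) := by
  rw [splits_seq_bridgeLayer, par_cup_swap_par]
  simp only [seq_par_wires, seq_assoc]
  rw [wire_par_swap_seq_wire_par_block_par, cup_par_seq_wires_par_block, cup_fswap_xspider_cps, seq_assoc]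

/-- The swap of the last two of four wires passes the leaf layer (bookkeeping). [folklore] (PROP axioms) -/
theorem wires_par_swap_seq_leafLayer {n : ℕ} (R : ZXClass 3 n) :
    (mk (wires 2) ⊠ mk swap) ⨟ ((((mk (Z 1 0 1) ⊠ mk (wires 1)) ⊠ mk (wires 1)) ⊠ mk (wires 1)) ⨟ R) = (((mk (Z 1 0 1) ⊠ mk (wires 1)) ⊠ mk (wires 1)) ⊠ mk (wires 1)) ⨟ ((mk (wires 1) ⊠ mk swap) ⨟ R) := by
  rw [← seq_assoc, ← seq_assoc, m4_rg21, interchange, id_seq, seq_id, interchange, seq_id, id_seq]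

/-- The swap of the last two of three wires passes a phase on the first (bookkeeping). [folklore] (PROP axioms) -/
theorem wire_par_swap_seq_phase_par_par {n : ℕ} (R : ZXClass 3 n) :
    (mk (wires 1) ⊠ mk swap) ⨟ (((mk (Z 1 1 1) ⊠ mk (wires 1)) ⊠ mk (wires 1)) ⨟ R) = ((mk (Z 1 1 1) ⊠ mk (wires 1)) ⊠ mk (wires 1)) ⨟ ((mk (wires 1) ⊠ mk swap) ⨟ R) := by
  rw [← seq_assoc, ← seq_assoc, m4_rg11, interchange, id_seq, seq_id, interchange, seq_id, id_seq]

/-- **The green/red edge flipped**: the gadget on the free leg followed by the final red merge equals a red split followed by a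
green merge (`cnot_alt`) and the remaining phase/`X(π/2)`. [cite: JeandelPerdrixVilmart2018, rule (S1); compact structure] -/
theorem gadget_seq_xmerge_eq_xsplit_seq_zmerge :
    (mk (wires 1) ⊠ (mk (Z 1 2 1) ⨟ (mk (wires 1) ⊠ mk (X 1 1 2)))) ⨟ (mk (X 2 1 0) ⊠ mk (wires 1)) = (mk (X 1 2 0) ⊠ mk (wires 1)) ⨟ ((mk (wires 1) ⊠ mk (Z 2 1 0)) ⨟ (mk (wires 1) ⊠ (mk (Z 1 1 1) ⨟ mk (X 1 1 2)))) := by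
  have h : (mk (wires 1) ⊠ (mk (wires 1) ⊠ (mk (Z 1 1 1) ⨟ mk (X 1 1 2)))) ⨟ (mk (X 2 1 0) ⊠ mk (wires 1)) = (mk (X 2 1 0) ⊠ mk (wires 1)) ⨟ (mk (wires 1) ⊠ (mk (Z 1 1 1) ⨟ mk (X 1 1 2))) := by
    rw [show mk (wires 1) ⊠ (mk (wires 1) ⊠ (mk (Z 1 1 1) ⨟ mk (X 1 1 2))) = mk (wires 2) ⊠ (mk (Z 1 1 1) ⨟ mk (X 1 1 2)) from by rw [← wires_par_wires 1 1]; exact (par_assoc' _ _ _).trans (cast_id _ _ _),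
      interchange, id_seq, seq_id, show mk (X 2 1 0) ⊠ (mk (Z 1 1 1) ⨟ mk (X 1 1 2)) = (mk (X 2 1 0) ⨟ mk (wires 1)) ⊠ (mk (wires 1) ⨟ (mk (Z 1 1 1) ⨟ mk (X 1 1 2))) from by rw [seq_id, id_seq], ← interchange]
  rw [show mk (Z 1 2 1) = mk (Z 1 2 0) ⨟ (mk (wires 1) ⊠ mk (Z 1 1 1)) from by rw [Z_seq_par_Z 1 1 1 1 le_rfl, zero_add], seq_assoc, ← wires_par_seq, wires_par_seq 1 (mk (Z 1 2 0)) _,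
    seq_assoc, h, ← seq_assoc, cnot21_eq, seq_assoc]

/-- The `2 → 2` red spider re-presented split-first inside the tail (bookkeeping). [cite: JeandelPerdrixVilmart2018, rule (S1)] -/
theorem xmerge_par_seq_xsplit_par_cps {n : ℕ} (R : ZXClass 3 n) :
    (mk (X 2 1 0) ⊠ mk (wires 1)) ⨟ ((mk (X 1 2 0) ⊠ mk (wires 1)) ⨟ R) = ((mk (X 1 2 0) ⊠ mk (wires 1)) ⊠ mk (wires 1)) ⨟ (((mk (wires 1) ⊠ mk swap) ⊠ mk (wires 1)) ⨟ (((mk (X 2 1 0) ⊠ mk (wires 1)) ⊠ mk (wires 1)) ⨟ R)) := by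
  rw [← seq_assoc, ← seq_par_wires, ← xsplit_swap_xmerge, seq_par_wires, seq_par_wires, seq_assoc, seq_assoc]

/-- The swap of the last two of three wires passes a red split on the first (bookkeeping). [folklore] (PROP axioms) -/
theorem wire_par_swap_seq_xsplit_par_par {n : ℕ} (R : ZXClass 4 n) :
    (mk (wires 1) ⊠ mk swap) ⨟ (((mk (X 1 2 0) ⊠ mk (wires 1)) ⊠ mk (wires 1)) ⨟ R) = ((mk (X 1 2 0) ⊠ mk (wires 1)) ⊠ mk (wires 1)) ⨟ ((mk (wires 2) ⊠ mk swap) ⨟ R) := by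
  rw [← seq_assoc, ← seq_assoc, m4_rg12x, interchange, id_seq, seq_id, interchange, seq_id, id_seq]

/-- The final red merge taken after the green merge block (bookkeeping). [folklore] (PROP axioms) -/
theorem xmerge_par_par_seq_block :
    ((mk (X 2 1 0) ⊠ mk (wires 1)) ⊠ mk (wires 1)) ⨟ ((mk (wires 1) ⊠ mk (Z 2 1 0)) ⨟ (mk (wires 1) ⊠ (mk (Z 1 1 1) ⨟ mk (X 1 1 2)))) = (mk (wires 2) ⊠ (mk (Z 2 1 0) ⨟ (mk (Z 1 1 1) ⨟ mk (X 1 1 2)))) ⨟ (mk (X 2 1 0) ⊠ mk (wires 1)) := by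
  rw [← wires_par_seq, m4_rg21, interchange, id_seq, seq_id, par_eq_seq_right]

/-- Routing the Hadamard wire past the green merge block (bookkeeping, `bswap` naturality). [folklore] (PROP axioms) -/
theorem wires_par_swap_seq_route {n : ℕ} (C : ZXClass 2 1) (R : ZXClass 3 n) :
    (mk (wires 2) ⊠ mk swap) ⨟ (((mk (wires 1) ⊠ mk swap) ⊠ mk (wires 1)) ⨟ ((mk (wires 2) ⊠ C) ⨟ R)) = ((mk (wires 1) ⊠ C) ⊠ mk (wires 1)) ⨟ ((mk (wires 1) ⊠ mk swap) ⨟ R) := by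
  have h : (mk (wires 2) ⊠ mk swap) ⨟ (((mk (wires 1) ⊠ mk swap) ⊠ mk (wires 1)) ⨟ (mk (wires 2) ⊠ C)) = ((mk (wires 1) ⊠ C) ⊠ mk (wires 1)) ⨟ (mk (wires 1) ⊠ mk swap) := by
    rw [show mk (wires 2) ⊠ mk swap = mk (wires 1) ⊠ (mk (wires 1) ⊠ mk swap) from by rw [← wires_par_wires 1 1]; exact (par_assoc _ _ _).trans (cast_id _ _ _),
      show (mk (wires 1) ⊠ mk swap) ⊠ mk (wires 1) = mk (wires 1) ⊠ (mk swap ⊠ mk (wires 1)) from (par_assoc _ _ _).trans (cast_id _ _ _),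
      show mk (wires 2) ⊠ C = mk (wires 1) ⊠ (mk (wires 1) ⊠ C) from by rw [← wires_par_wires 1 1]; exact (par_assoc _ _ _).trans (cast_id _ _ _),
      ← wires_par_seq, ← wires_par_seq, ← seq_assoc (mk (wires 1) ⊠ mk swap) (mk swap ⊠ mk (wires 1)) _, ← bswap1_two, bswap1_seq_wires_par, bswap1_one, wires_par_seq,
      show mk (wires 1) ⊠ (C ⊠ mk (wires 1)) = (mk (wires 1) ⊠ C) ⊠ mk (wires 1) from (par_assoc' _ _ _).trans (cast_id _ _ _)]
  rw [← seq_assoc ((mk (wires 1) ⊠ mk swap) ⊠ mk (wires 1)) (mk (wires 2) ⊠ C) R, ← seq_assoc (mk (wires 2) ⊠ mk swap) _ R, h, seq_assoc]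

/-- Taking a `1 → 1` block out of a parallel composition in front (bookkeeping). [folklore] (PROP axioms) -/
theorem seq_par_eq_par_seq_par_wire (P : ZXClass 1 1) (B' : ZXClass 1 2) (H' : ZXClass 1 1) : (P ⨟ B') ⊠ H' = (P ⊠ H') ⨟ (B' ⊠ mk (wires 1)) := by
  rw [interchange, seq_id]

/-- **`Y_L`, stage 3**: the cup-free bent form equals the spine form produced by the left half of the Lemma-35 chain: the
green/red edge is flipped (`cnot_alt`), the `2 → 2` red spider re-presented, and the Hadamard wire routed last.
[cite: JeandelPerdrixVilmart2018, rule (S1); PROP axioms] -/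
theorem Y_L_stage3 : mk (X 1 2 0) ⨟ (mk (Z 1 1 (-3)) ⊠ mk hBox) ⨟ (mk (X 1 3 0) ⊠ mk (wires 1)) ⨟ (mk (wires 2) ⊠ mk swap) ⨟ (((mk (Z 1 0 1) ⊠ mk (wires 1)) ⊠ mk (wires 1)) ⊠ mk (wires 1)) ⨟ ((mk (Z 1 1 1) ⊠ mk (wires 1)) ⊠ mk (wires 1)) ⨟ (mk (X 2 1 0) ⊠ mk (wires 1)) ⨟ ((mk (wires 1) ⊠ (mk (Z 1 2 1) ⨟ (mk (wires 1) ⊠ mk (X 1 1 2)))) ⨟ (mk (X 2 1 0) ⊠ mk (wires 1))) = mk (X 1 2 0) ⨟ ((mk (Z 1 1 (-3)) ⨟ (mk (X 1 3 0) ⨟ ((mk (Z 1 0 1) ⊠ mk (wires 1)) ⊠ mk (wires 1)) ⨟ ((mk (Z 1 1 1) ⨟ mk (X 1 2 0)) ⊠ mk (wires 1)) ⨟ (mk (wires 1) ⊠ mk (Z 2 1 0))) ⨟ (mk (wires 1) ⊠ (mk (Z 1 1 1) ⨟ mk (X 1 1 2)))) ⊠ mk hBox) ⨟ (mk (wires 1)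 ⊠ mk swap) ⨟ (mk (X 2 1 0) ⊠ mk (wires 1)) := by
  simp only [seq_assoc]
  rw [seq_par_eq_par_seq_par_wire (mk (Z 1 1 (-3)))]
  simp only [seq_par_wires, seq_assoc]
  rw [wires_par_swap_seq_leafLayer, wire_par_swap_seq_phase_par_par, gadget_seq_xmerge_eq_xsplit_seq_zmerge, xmerge_par_seq_xsplit_par_cps,
    wire_par_swap_seq_xsplit_par_par, xmerge_par_par_seq_block, wires_par_swap_seq_route]
  simp only [wires_par_seq, seq_par_wires, seq_assoc]

/-- **Bending the Hadamard-branch block by its first input** (`Y_L`). [cite: JeandelPerdrixVilmart2018, rule (S1); compact structure] -/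
theorem Y_L : (mk (wires 1) ⊠ mk cup) ⨟ (mk swap ⊠ mk (wires 1)) ⨟ (((mk (Z 1 1 3) ⊠ mk (wires 1)) ⨟ (mk (X 1 3 0) ⊠ mk (X 1 2 0)) ⨟ (((mk (Z 1 0 1) ⊠ mk (wires 1)) ⊠ ((mk (Z 1 1 (-3)) ⊠ mk (wires 1)) ⨟ mk cap)) ⊠ mk hBox) ⨟ (mk (Z 1 1 1) ⊠ mk (wires 1)) ⨟ mk (X 2 1 0)) ⊠ mk (wires 1)) ⨟ ((mk (wires 1) ⊠ (mk (Z 1 2 (-2)) ⨟ (mk (wires 1) ⊠ mk (X 1 1 2)))) ⨟ (mk (X 2 1 0) ⊠ mk (wires 1))) = mk (X 1 2 0) ⨟ ((mk (Z 1 1 (-3)) ⨟ (mk (X 1 3 0) ⨟ ((mk (Z 1 0 1) ⊠ mk (wires 1)) ⊠ mk (wires 1)) ⨟ ((mk (Z 1 1 1) ⨟ mk (X 1 2 0)) ⊠ mk (wires 1)) ⨟ (mk (wires 1) ⊠ mk (Z 2 1 0))) ⨟ (mk (wires 1) ⊠ (mk (Z 1 1 1) ⨟ mk (X 1 1 2))))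 ⊠ mk hBox) ⨟ (mk (wires 1) ⊠ mk swap) ⨟ (mk (X 2 1 0) ⊠ mk (wires 1)) := Y_L_stage1.trans (Y_L_stage2.trans Y_L_stage3)

/-- **The middle of the Lemma-35 chain (`MID`)**: the left spine form equals the right spine form — Appendix Lemma 34 in
Hadamard-branch form, bent. [cite: JeandelPerdrixVilmart2018, Appendix Lemma 34; proof of Lemma 35, step (picom, Lemma 34)] -/
theorem L35_mid : mk (X 1 2 0) ⨟ ((mk (Z 1 1 (-3)) ⨟ (mk (X 1 3 0) ⨟ ((mk (Z 1 0 1) ⊠ mk (wires 1)) ⊠ mk (wires 1)) ⨟ ((mk (Z 1 1 1) ⨟ mk (X 1 2 0)) ⊠ mk (wires 1)) ⨟ (mk (wires 1) ⊠ mk (Z 2 1 0))) ⨟ (mk (wires 1) ⊠ (mk (Z 1 1 1) ⨟ mk (X 1 1 2)))) ⊠ mk hBox) ⨟ (mk (wires 1) ⊠ mk swap) ⨟ (mk (X 2 1 0) ⊠ mk (wires 1)) = mk (Z 1 1 (-3)) ⨟ mk (X 1 3 0) ⨟ ((mk (Z 1 0 1) ⊠ mk (wires 1)) ⊠ mk (wires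 1)) ⨟ ((mk (Z 1 1 1) ⊠ (mk (Z 1 1 3) ⨟ mk (X 1 2 0) ⨟ (mk hBox ⊠ (mk (Z 1 2 (-2)) ⨟ (mk (wires 1) ⊠ mk (X 1 1 2)))))) ⨟ ((mk (X 2 1 0) ⊠ mk (wires 1)) ⊠ mk (wires 1)) ⨟ (mk (X 2 1 0) ⊠ mk (wires 1))) := by
  have h : (mk (wires 1) ⊠ mk cup) ⨟ (mk swap ⊠ mk (wires 1)) ⨟ (((mk (Z 1 1 3) ⊠ mk (wires 1)) ⨟ (mk (X 1 3 0) ⊠ mk (X 1 2 0)) ⨟ (((mk (Z 1 0 1) ⊠ mk (wires 1)) ⊠ ((mk (Z 1 1 (-3)) ⊠ mk (wires 1)) ⨟ mk cap)) ⊠ mk hBox) ⨟ (mk (Z 1 1 1) ⊠ mk (wires 1)) ⨟ mk (X 2 1 0)) ⊠ mk (wires 1)) ⨟ ((mk (wires 1) ⊠ (mk (Z 1 2 (-2)) ⨟ (mk (wires 1) ⊠ mk (X 1 1 2)))) ⨟ (mk (X 2 1 0) ⊠ mk (wires 1))) = (mk (wires 1) ⊠ mk cup) ⨟ (((mk (Z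 1 1 (-3)) ⊠ mk (wires 1)) ⨟ (mk (X 1 3 0) ⊠ mk (X 1 2 0)) ⨟ (((mk (Z 1 0 1) ⊠ mk (wires 1)) ⊠ ((mk (Z 1 1 3) ⊠ mk (wires 1)) ⨟ mk cap)) ⊠ mk hBox) ⨟ (mk (Z 1 1 1) ⊠ mk (wires 1)) ⨟ mk (X 2 1 0)) ⊠ mk (wires 1)) ⨟ ((mk (wires 1) ⊠ (mk (Z 1 2 (-2)) ⨟ (mk (wires 1) ⊠ mk (X 1 1 2)))) ⨟ (mk (X 2 1 0) ⊠ mk (wires 1))) := by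
    rw [L34h, seq_par_wires, ← seq_assoc ((mk (wires 1) ⊠ mk cup) ⨟ (mk swap ⊠ mk (wires 1))) (mk swap ⊠ mk (wires 1)) _, seq_assoc (mk (wires 1) ⊠ mk cup) (mk swap ⊠ mk (wires 1)) (mk swap ⊠ mk (wires 1)),
      ← seq_par_wires, swap_seq_swap, wires_par_wires, seq_id]
  exact Y_L.symm.trans (h.trans Y_R)

end ZXClass

end Literature.Computability.QuantumComplexity


/-!
# ZX-calculus: Appendix Lemma 35 (`triangle through W`) — the two halves of the chain
[cite: JeandelPerdrixVilmart2018, Appendix, Lemma 35 and its proof]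
-/

namespace Literature.Computability.QuantumComplexity

open ZXDiagram

namespace ZXClass

/-- Scalar mover (bookkeeping): `A ⨾ (s ⊗ B) = s ⊗ (A ⨾ B)` for `A : 1 → 2`, `B : 2 → 2`. [folklore] -/
private theorem m5_r122 (A : ZXClass 1 2) (s : ZXClass 0 0) (B : ZXClass 2 2) : A ⨟ (s ⊠ B) = s ⊠ (A ⨟ B) := by
  rw [scalar_par_seq_right, empty_par, cast_id]

/-- Scalar mover (bookkeeping): `A ⨾ (s ⊗ B) = s ⊗ (A ⨾ B)` for `A : 1 → 1`, `B : 1 → 2`. [folklore] -/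
private theorem m5_r112 (A : ZXClass 1 1) (s : ZXClass 0 0) (B : ZXClass 1 2) : A ⨟ (s ⊠ B) = s ⊠ (A ⨟ B) := by
  rw [scalar_par_seq_right, empty_par, cast_id]

/-- Regrouping (bookkeeping): `(E ⊗ 𝕀) ⊗ 𝕀 = E ⊗ 𝕀²` for an effect `E`. [folklore] -/
private theorem m5_rg10 (E : ZXClass 1 0) : (E ⊠ mk (wires 1)) ⊠ mk (wires 1) = E ⊠ mk (wires 2) := by
  rw [← wires_par_wires 1 1]; exact (par_assoc _ _ _).trans (cast_id _ _ _)

/-- **The bialgebra step of Lemma 35** (figs. `…c1_03 → 04` and `11 → 10`): a red node with a `π/4` leaf, a green split and a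
second red node with a `π/4` leaf on its second output equal `√2 ⊗` a red `X^{(1,3)}` with the first leaf, a `π/4` phase and a
red split on its second output, and a green merge of that split's second output with the third output.
[cite: JeandelPerdrixVilmart2018, rules (B2) (as `rule_B2_cnot`), (S1); Appendix, proof of Lemma 35] -/
theorem xLeafL_split_xLeafL_eq :
    mk (xLeafL 0 1) ⨟ mk (Z 1 2 0) ⨟ (mk (wires 1) ⊠ mk (xLeafL 0 1)) = mk (dumbbell 0 0) ⊠ (mk (X 1 3 0) ⨟ ((mk (Z 1 0 1) ⊠ mk (wires 1)) ⊠ mk (wires 1)) ⨟ ((mk (Z 1 1 1) ⨟ mk (X 1 2 0)) ⊠ mk (wires 1)) ⨟ (mk (wires 1) ⊠ mk (Z 2 1 0))) := by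
  have h1 : mk (Z 1 2 0) ⨟ (mk (wires 2) ⊠ mk (Z 0 1 1)) = (mk (wires 1) ⊠ mk (Z 0 1 1)) ⨟ (mk (Z 1 2 0) ⊠ mk (wires 1)) := by
    rw [show mk (Z 1 2 0) ⨟ (mk (wires 2) ⊠ mk (Z 0 1 1)) = (mk (Z 1 2 0) ⊠ mk (wires 0)) ⨟ (mk (wires 2) ⊠ mk (Z 0 1 1)) from by rw [par_empty],
      interchange, seq_id, id_seq, show mk (Z 1 2 0) ⊠ mk (Z 0 1 1) = (mk (wires 1) ⨟ mk (Z 1 2 0)) ⊠ (mk (Z 0 1 1) ⨟ mk (wires 1)) from by rw [id_seq, seq_id], ← interchange]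
  have h2 : (mk (wires 1) ⊠ mk (Z 0 1 1)) ⨟ ((mk (X 1 2 0) ⊠ mk (wires 1)) ⨟ (mk (wires 1) ⊠ mk (Z 2 1 0))) = mk (X 1 2 0) ⨟ (mk (wires 1) ⊠ mk (Z 1 1 1)) := by
    rw [← seq_assoc, interchange, id_seq, seq_id, show mk (X 1 2 0) ⊠ mk (Z 0 1 1) = (mk (X 1 2 0) ⨟ mk (wires 2)) ⊠ (mk (wires 0) ⨟ mk (Z 0 1 1)) from by rw [seq_id, id_seq],
      ← interchange, par_empty, seq_assoc, show mk (wires 2) ⊠ mk (Z 0 1 1) = mk (wires 1) ⊠ (mk (wires 1) ⊠ mk (Z 0 1 1)) from by rw [← wires_par_wires 1 1]; exact (par_assoc _ _ _).trans (cast_id _ _ _),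
      ← wires_par_seq, par_Z_seq_Z 1 0 1 1 le_rfl, zero_add]
  have h3 : (mk (Z 1 0 1) ⊠ mk (wires 1)) ⨟ mk (X 1 2 0) = (mk (wires 1) ⊠ mk (X 1 2 0)) ⨟ ((mk (Z 1 0 1) ⊠ mk (wires 1)) ⊠ mk (wires 1)) := by
    nth_rewrite 1 [show mk (X 1 2 0) = mk (wires 0) ⊠ mk (X 1 2 0) from ((empty_par (mk (X 1 2 0))).trans (cast_id _ _ _)).symm]
    rw [interchange, seq_id, id_seq, par_eq_seq_right, m5_rg10]
  have hsw : (mk (wires 1) ⊠ mk (Z 1 1 1)) ⨟ mk swap = mk swap ⨟ (mk (Z 1 1 1) ⊠ mk (wires 1)) := (swap_seq_par_one_one (mk (Z 1 1 1)) (mk (wires 1))).symm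
  nth_rewrite 2 [← par_Z_state_seq_X_merge 1 0]
  rw [wires_par_seq, show mk (wires 1) ⊠ (mk (wires 1) ⊠ mk (Z 0 1 1)) = mk (wires 2) ⊠ mk (Z 0 1 1) from by rw [← wires_par_wires 1 1]; exact (par_assoc' _ _ _).trans (cast_id _ _ _),
    seq_assoc (mk (xLeafL 0 1)) (mk (Z 1 2 0)) _, ← seq_assoc (mk (Z 1 2 0)) (mk (wires 2) ⊠ mk (Z 0 1 1)) _, h1, seq_assoc (mk (wires 1) ⊠ mk (Z 0 1 1)), rule_B2_cnot,
    m5_r122, m5_r112, ← seq_assoc (mk (wires 1) ⊠ mk (Z 0 1 1)) _ ((mk (X 1 2 0) ⊠ mk (wires 1)) ⨟ (mk (wires 1) ⊠ mk (Z 2 1 0))), ← seq_assoc (mk (wires 1) ⊠ mk (Z 0 1 1)) ((mk (X 1 2 0) ⊠ mk (wires 1)) ⨟ (mk (wires 1) ⊠ mk (Z 2 1 0))) (mk swap), h2,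
    seq_assoc (mk (X 1 2 0)) (mk (wires 1) ⊠ mk (Z 1 1 1)) (mk swap), hsw, ← seq_assoc (mk (X 1 2 0)) (mk swap) _, X_seq_swap, seq_assoc (mk (X 1 2 0)) (mk (Z 1 1 1) ⊠ mk (wires 1)) _,
    ← seq_assoc (mk (Z 1 1 1) ⊠ mk (wires 1)) (mk (X 1 2 0) ⊠ mk (wires 1)) _, ← seq_par_wires,
    show mk (xLeafL 0 1) = mk (X 1 2 0) ⨟ (mk (Z 1 0 1) ⊠ mk (wires 1)) from by simp only [xLeafL, mk_seq, mk_par],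
    seq_assoc (mk (X 1 2 0)) (mk (Z 1 0 1) ⊠ mk (wires 1)) _, ← seq_assoc (mk (Z 1 0 1) ⊠ mk (wires 1)) (mk (X 1 2 0)) _, h3,
    seq_assoc (mk (wires 1) ⊠ mk (X 1 2 0)) _ _, ← seq_assoc (mk (X 1 2 0)) (mk (wires 1) ⊠ mk (X 1 2 0)) _, X_seq_par_X 1 1 1 2 le_rfl, add_zero]
  simp only [seq_assoc]

/-- Scalar mover (bookkeeping): `(s ⊗ A) ⨾ B = s ⊗ (A ⨾ B)` for `A : 1 → 1`, `B : 1 → 2`. [folklore] -/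
private theorem m5_l112 (s : ZXClass 0 0) (A : ZXClass 1 1) (B : ZXClass 1 2) : (s ⊠ A) ⨟ B = s ⊠ (A ⨟ B) := by
  rw [scalar_par_seq_left, empty_par, cast_id]


/-- Scalar mover (bookkeeping): `(s ⊗ A) ⨾ B = s ⊗ (A ⨾ B)` for `A : 1 → 1`, `B : 1 → 3`. [folklore] -/
private theorem m5_l113 (s : ZXClass 0 0) (A : ZXClass 1 1) (B : ZXClass 1 3) : (s ⊠ A) ⨟ B = s ⊠ (A ⨟ B) := by
  rw [scalar_par_seq_left, empty_par, cast_id]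

/-- Scalar mover (bookkeeping): `A ⨾ (s ⊗ B) = s ⊗ (A ⨾ B)` for `A B : 1 → 1`. [folklore] -/
private theorem m5_r111 (A : ZXClass 1 1) (s : ZXClass 0 0) (B : ZXClass 1 1) : A ⨟ (s ⊠ B) = s ⊠ (A ⨟ B) := by
  rw [scalar_par_seq_right, empty_par, cast_id]

/-- **`X(π) ⨾ Tᵗ ⨾ X(π)` explicitly**: the conjugated transposed triangle is `X(-π/2) ⨾ Z(π/4) ⨾` the `π`-leafed red node `⨾` the
`π`-gadget node. [cite: JeandelPerdrixVilmart2018, Appendix Lemma (not-triangle is symmetrical), rules (S1), (K)] -/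
theorem Xpi_triangleT_Xpi :
    mk (X 1 1 4) ⨟ (mk triangle).transpose ⨟ mk (X 1 1 4) = mk (X 1 1 (-2)) ⨟ mk (Z 1 1 1) ⨟ mk (xLeafL 4 1) ⨟ (mk (Z 1 2 0) ⨟ (mk (wires 1) ⊠ (mk (X 1 2 4) ⨟ (mk (Z 1 0 (-1)) ⊠ mk (Z 1 0 (-1)))))) := by
  rw [triangle_transpose_explicit]
  simp only [seq_assoc]
  rw [← seq_assoc (mk (Z 1 2 0)) _ (mk (X 1 1 4)), gadgetNode_seq_X_pi, ← seq_assoc (mk (xLeafL 0 1)) (mk (X 1 1 4)) _, xLeafL_zero_seq_X_pi,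
    ← seq_assoc (mk (X 1 1 4)) (mk (X 1 1 2)) _, xphase_seq_xphase, show (4 : ZMod 8) + 2 = -2 from by decide]

/-- **The two gadgets of Lemma 35 cancel** (fig. `…c1_02 → 03`, supplementarity): the `π`-gadget node coming from the transposed
triangle passes the split and meets the gadget node of the second triangle; the pair is the scalar `X_π ⨾ Z(-π/2)`; `1 → 1` tail.
[cite: JeandelPerdrixVilmart2018, Lemma (supplementarity to −π/4) via `gadgetNode_pi_seq_gadgetNode`; Appendix, proof of Lemma 35] -/
theorem gadgets_cancel_one (R : ZXClass 1 1) :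
    mk (Z 1 2 0) ⨟ ((mk (wires 1) ⊠ (mk (X 1 2 4) ⨟ (mk (Z 1 0 (-1)) ⊠ mk (Z 1 0 (-1))))) ⨟ (mk (Z 1 2 0) ⨟ (mk (wires 1) ⊠ (mk (Z 1 2 0) ⨟ ((mk (wires 1) ⊠ (mk (X 1 2 0) ⨟ (mk (Z 1 0 (-1)) ⊠ mk (Z 1 0 (-1))))) ⨟ R))))) = mk (dumbbell 4 (-2)) ⊠ (mk (Z 1 2 0) ⨟ (mk (wires 1) ⊠ R)) := by
  rw [← seq_assoc (mk (Z 1 2 0)) (mk (wires 1) ⊠ (mk (X 1 2 0) ⨟ (mk (Z 1 0 (-1)) ⊠ mk (Z 1 0 (-1))))) R, wires_par_seq 1 (mk (Z 1 2 0) ⨟ (mk (wires 1) ⊠ (mk (X 1 2 0) ⨟ (mk (Z 1 0 (-1)) ⊠ mk (Z 1 0 (-1)))))) R, ← seq_assoc (mk (Z 1 2 0)) (mk (wires 1) ⊠ (mk (Z 1 2 0) ⨟ (mk (wires 1) ⊠ (mk (X 1 2 0) ⨟ (mk (Z 1 0 (-1)) ⊠ mk (Z 1 0 (-1))))))) _,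 split_seq_par_gadget,
    ← seq_assoc (mk (Z 1 2 0)) (mk (wires 1) ⊠ (mk (X 1 2 4) ⨟ (mk (Z 1 0 (-1)) ⊠ mk (Z 1 0 (-1))))) _, seq_assoc (mk (Z 1 2 0) ⨟ (mk (wires 1) ⊠ (mk (X 1 2 0) ⨟ (mk (Z 1 0 (-1)) ⊠ mk (Z 1 0 (-1)))))) (mk (Z 1 2 0)) _,
    ← seq_assoc (mk (Z 1 2 0) ⨟ (mk (wires 1) ⊠ (mk (X 1 2 4) ⨟ (mk (Z 1 0 (-1)) ⊠ mk (Z 1 0 (-1)))))) (mk (Z 1 2 0) ⨟ (mk (wires 1) ⊠ (mk (X 1 2 0) ⨟ (mk (Z 1 0 (-1)) ⊠ mk (Z 1 0 (-1)))))) _, gadgetNode_pi_seq_gadgetNode, m5_l112, id_seq]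

/-- **The two gadgets of Lemma 35 cancel**, `1 → 2` tail (right half of the chain). [cite: JeandelPerdrixVilmart2018, as above] -/
theorem gadgets_cancel_two (R : ZXClass 1 2) :
    mk (Z 1 2 0) ⨟ ((mk (wires 1) ⊠ (mk (X 1 2 4) ⨟ (mk (Z 1 0 (-1)) ⊠ mk (Z 1 0 (-1))))) ⨟ (mk (Z 1 2 0) ⨟ (mk (wires 1) ⊠ (mk (Z 1 2 0) ⨟ ((mk (wires 1) ⊠ (mk (X 1 2 0) ⨟ (mk (Z 1 0 (-1)) ⊠ mk (Z 1 0 (-1))))) ⨟ R))))) = mk (dumbbell 4 (-2)) ⊠ (mk (Z 1 2 0) ⨟ (mk (wires 1) ⊠ R)) := by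
  rw [← seq_assoc (mk (Z 1 2 0)) (mk (wires 1) ⊠ (mk (X 1 2 0) ⨟ (mk (Z 1 0 (-1)) ⊠ mk (Z 1 0 (-1))))) R, wires_par_seq 1 (mk (Z 1 2 0) ⨟ (mk (wires 1) ⊠ (mk (X 1 2 0) ⨟ (mk (Z 1 0 (-1)) ⊠ mk (Z 1 0 (-1)))))) R, ← seq_assoc (mk (Z 1 2 0)) (mk (wires 1) ⊠ (mk (Z 1 2 0) ⨟ (mk (wires 1) ⊠ (mk (X 1 2 0) ⨟ (mk (Z 1 0 (-1)) ⊠ mk (Z 1 0 (-1))))))) _, split_seq_par_gadget,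
    ← seq_assoc (mk (Z 1 2 0)) (mk (wires 1) ⊠ (mk (X 1 2 4) ⨟ (mk (Z 1 0 (-1)) ⊠ mk (Z 1 0 (-1))))) _, seq_assoc (mk (Z 1 2 0) ⨟ (mk (wires 1) ⊠ (mk (X 1 2 0) ⨟ (mk (Z 1 0 (-1)) ⊠ mk (Z 1 0 (-1)))))) (mk (Z 1 2 0)) _,
    ← seq_assoc (mk (Z 1 2 0) ⨟ (mk (wires 1) ⊠ (mk (X 1 2 4) ⨟ (mk (Z 1 0 (-1)) ⊠ mk (Z 1 0 (-1)))))) (mk (Z 1 2 0) ⨟ (mk (wires 1) ⊠ (mk (X 1 2 0) ⨟ (mk (Z 1 0 (-1)) ⊠ mk (Z 1 0 (-1)))))) _, gadgetNode_pi_seq_gadgetNode, m5_l113, id_seq]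

/-- **The `π` from `X(-π/2)` commutes down to the leaf** (fig. `…c1_02 → 03`, "picom"): `√2 ⊗ (X(-π/2) ⨾ Z(π/4) ⨾ L_π) =
(X_π ⨾ Z(π/4)) ⊗ (X(π/2) ⨾ Z(-π/4) ⨾ L_0)`, `L_k` the red node with the `π/4` leaf. [cite: JeandelPerdrixVilmart2018, rules (K), (S1)] -/
theorem top_picom (R : ZXClass 1 2) :
    mk (dumbbell 0 0) ⊠ (mk (X 1 1 (-2)) ⨟ (mk (Z 1 1 1) ⨟ (mk (xLeafL 4 1) ⨟ R))) = mk (dumbbell 4 1) ⊠ (mk (X 1 1 2) ⨟ (mk (Z 1 1 (-1)) ⨟ (mk (xLeafL 0 1) ⨟ R))) := by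
  have hx : mk (X 1 1 4) ⨟ mk (xLeafL 4 1) = mk (xLeafL 0 1) := by
    rw [← X_pi_seq_xLeafL, ← seq_assoc, xphase_seq_xphase, show (4 : ZMod 8) + 4 = 0 from by decide, X_one_one, id_seq]
  rw [show mk (X 1 1 (-2)) = mk (X 1 1 2) ⨟ mk (X 1 1 4) from by rw [xphase_seq_xphase, show (2 : ZMod 8) + 4 = -2 from by decide], seq_assoc,
    ← seq_assoc (mk (X 1 1 4)) (mk (Z 1 1 1)) _, scalar_par_seq_right (mk (dumbbell 0 0)) (mk (X 1 1 2)) _, empty_par, cast_id, scalar_par_seq_left (mk (dumbbell 0 0)) _ _,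
    rule_K_red, ← scalar_par_seq_left, m5_r112, seq_assoc (mk (Z 1 1 (-1))) (mk (X 1 1 4)) _, ← seq_assoc (mk (X 1 1 4)) (mk (xLeafL 4 1)) R, hx]

/-- **Euler decomposition at the top** (figs. `…c1_03 → 04` and `09 → 08`): `X(π/2) ⨾ Z(-π/4) = (1/√2)·(X_π⨾Z(π/4)) ⊗ (Z(-π/2) ⨾ H ⨾ Z(-3π/4))`.
[cite: JeandelPerdrixVilmart2018, Lemma (Euler decomposition with scalars) via `euler_pos`] -/
theorem X_two_seq_Z_neg_one_eq : mk (X 1 1 2) ⨟ mk (Z 1 1 (-1)) = mk invSqrtTwo ⊠ (mk (dumbbell 4 1) ⊠ (mk (Z 1 1 (-2)) ⨟ mk hBox ⨟ mk (Z 1 1 (-3)))) := by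
  rw [show mk (Z 1 1 (-1)) = mk (Z 1 1 2) ⨟ mk (Z 1 1 (-3)) from by rw [phase_seq_phase, show (2 : ZMod 8) + -3 = -1 from by decide], ← seq_assoc,
    show mk (X 1 1 2) ⨟ mk (Z 1 1 2) = mk (Z 1 1 (-2)) ⨟ (mk (Z 1 1 2) ⨟ mk (X 1 1 2) ⨟ mk (Z 1 1 2)) from by
      rw [← seq_assoc, ← seq_assoc, phase_seq_phase, show (-2 : ZMod 8) + 2 = 0 from by decide, Z_one_one, id_seq],
    euler_pos, m5_r111, m5_r111, scalar_par_seq_one, scalar_par_seq_one]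

/-- Scalar mover (bookkeeping): `𝕀 ⊗ (s ⊗ C) = s ⊗ (𝕀 ⊗ C)` for `C : 1 → 2`. [folklore] -/
private theorem m5_w_s_12 (s : ZXClass 0 0) (C : ZXClass 1 2) : mk (wires 1) ⊠ (s ⊠ C) = s ⊠ (mk (wires 1) ⊠ C) := by
  rw [show mk (wires 1) ⊠ (s ⊠ C) = ((mk (wires 1) ⊠ s) ⊠ C).cast rfl rfl from (par_assoc' _ _ _).trans rfl, cast_id, ← scalar_par_wires,
    show (s ⊠ mk (wires 1)) ⊠ C = (s ⊠ (mk (wires 1) ⊠ C)).cast rfl rfl from (par_assoc _ _ _).trans rfl, cast_id]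

/-- Scalar mover (bookkeeping): `(s ⊗ D) ⨾ E = s ⊗ (D ⨾ E)` for `D : 2 → 3`, `E : 3 → 2`. [folklore] -/
private theorem m5_l232 (s : ZXClass 0 0) (D : ZXClass 2 3) (E : ZXClass 3 2) : (s ⊠ D) ⨟ E = s ⊠ (D ⨟ E) := by
  rw [scalar_par_seq_left, empty_par, cast_id]

/-- The final merge of the fork passes the outer triangle (bookkeeping). [folklore] (PROP axioms) -/
theorem xmerge_par_seq_wire_par (A : ZXClass 1 1) : (mk (X 2 1 0) ⊠ mk (wires 1)) ⨟ (mk (wires 1) ⊠ A) = (mk (wires 2) ⊠ A) ⨟ (mk (X 2 1 0) ⊠ mk (wires 1)) := by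
  rw [interchange, seq_id, id_seq, interchange, id_seq, seq_id]

/-- Scalar mover (bookkeeping): `(s ⊗ A) ⨾ B = s ⊗ (A ⨾ B)` for `A : 1 → 2`, `B : 2 → 2`. [folklore] -/
private theorem m5_l122 (s : ZXClass 0 0) (A : ZXClass 1 2) (B : ZXClass 2 2) : (s ⊠ A) ⨟ B = s ⊠ (A ⨟ B) := by
  rw [scalar_par_seq_left, empty_par, cast_id]

/-- Scalar mover (bookkeeping): `(s ⊗ C) ⊗ H = s ⊗ (C ⊗ H)` for `C : 1 → 2`, `H : 1 → 1`. [folklore] -/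
private theorem m5_sCH (s : ZXClass 0 0) (C : ZXClass 1 2) (H' : ZXClass 1 1) : (s ⊠ C) ⊠ H' = s ⊠ (C ⊠ H') :=
  (par_assoc _ _ _).trans (cast_id _ _ _)

/-- Step of the Lemma-35 chain (bookkeeping): the fork's green split with the block on its second output and the merge on
its first equals the same with the block on the first output, a swap, and the merge (`Z^{(1,2)} ⨾ σ = Z^{(1,2)}`).
[cite: JeandelPerdrixVilmart2018, rule (S1); PROP axioms] -/
theorem split_seq_wire_par_block_seq_xmerge (B : ZXClass 1 2) :
    mk (Z 1 2 0) ⨟ ((mk (wires 1) ⊠ B) ⨟ (mk (X 2 1 0) ⊠ mk (wires 1))) = mk (Z 1 2 0) ⨟ ((B ⊠ mk (wires 1)) ⨟ ((mk (wires 1) ⊠ mk swap) ⨟ (mk (X 2 1 0) ⊠ mk (wires 1)))) := by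
  have hsn : mk swap ⨟ (mk (wires 1) ⊠ B) = (B ⊠ mk (wires 1)) ⨟ mk (bswap1 2) := by
    rw [← bswap1_one]; exact bswap1_seq_wires_par _
  nth_rewrite 1 [← Z_seq_swap 1 0]
  rw [seq_assoc, ← seq_assoc (mk swap) (mk (wires 1) ⊠ B) _, hsn, bswap1_two, seq_assoc (B ⊠ mk (wires 1)) _ _, seq_assoc (mk (wires 1) ⊠ mk swap) (mk swap ⊠ mk (wires 1)) _,
    ← seq_par_wires (mk swap) (mk (X 2 1 0)) 1, swap_seq_X]

/-- Step of the Lemma-35 chain: the `Z(-π/2)` at the top of the block fuses into the fork's split, the split changes colour, and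
the Hadamards cancel, leaving a red split with the block on its first output and a Hadamard on the second.
[cite: JeandelPerdrixVilmart2018, rules (S1), (H); Lemma (Hadamard involution)] -/
theorem split_seq_topBlock {n : ℕ} (B2 : ZXClass 1 2) (R : ZXClass 3 n) :
    mk (Z 1 2 0) ⨟ (((((mk (Z 1 1 (-2)) ⨟ mk hBox) ⨟ mk (Z 1 1 (-3))) ⨟ B2) ⊠ mk (wires 1)) ⨟ R) =
      mk (Z 1 1 (-2)) ⨟ (mk hBox ⨟ (mk (X 1 2 0) ⨟ (((mk (Z 1 1 (-3)) ⨟ B2) ⊠ mk hBox) ⨟ R))) := by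
  have h1 : (mk hBox ⊠ mk hBox) ⨟ (mk hBox ⊠ mk (wires 1)) = mk (wires 1) ⊠ mk hBox := by rw [interchange, hBox_seq_hBox, seq_id]
  have h2 : ∀ R' : ZXClass 3 n, (mk (wires 1) ⊠ mk hBox) ⨟ ((mk (Z 1 1 (-3)) ⊠ mk (wires 1)) ⨟ ((B2 ⊠ mk (wires 1)) ⨟ R')) = ((mk (Z 1 1 (-3)) ⨟ B2) ⊠ mk hBox) ⨟ R' := fun R' => by
    rw [← seq_assoc, ← seq_assoc, interchange, id_seq, seq_id, interchange, seq_id]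
  rw [seq_par_wires, seq_par_wires, seq_par_wires, seq_assoc, seq_assoc, seq_assoc, ← seq_assoc (mk (Z 1 2 0)) (mk (Z 1 1 (-2)) ⊠ mk (wires 1)) _,
    Z_seq_Z_par 1 1 1 1 le_rfl, add_zero, show mk (Z 1 (1 + 1) (-2)) = mk (Z 1 1 (-2)) ⨟ mk (Z 1 2 0) from by rw [Z_seq_Z 1 1 2 le_rfl, add_zero],
    Z_eq_conj 1 2 0, hTensor_one, hTensor_two, seq_assoc, seq_assoc, seq_assoc, ← seq_assoc (mk hBox ⊠ mk hBox) (mk hBox ⊠ mk (wires 1)) _, h1, h2]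

/-- Step of the Lemma-35 chain: the bialgebra step inside the block of the left half. [cite: JeandelPerdrixVilmart2018, rules (B2), (S1)] -/
theorem leftBlock_bialgebra :
    mk (Z 1 1 (-3)) ⨟ (mk (xLeafL 0 1) ⨟ (mk (Z 1 2 0) ⨟ (mk (wires 1) ⊠ (mk (xLeafL 0 1) ⨟ (mk (Z 1 1 1) ⨟ mk (X 1 1 2)))))) =
      mk (dumbbell 0 0) ⊠ (mk (Z 1 1 (-3)) ⨟ ((mk (X 1 3 0) ⨟ ((mk (Z 1 0 1) ⊠ mk (wires 1)) ⊠ mk (wires 1)) ⨟ ((mk (Z 1 1 1) ⨟ mk (X 1 2 0)) ⊠ mk (wires 1)) ⨟ (mk (wires 1) ⊠ mk (Z 2 1 0))) ⨟ (mk (wires 1) ⊠ (mk (Z 1 1 1) ⨟ mk (X 1 1 2))))) := by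
  rw [wires_par_seq 1 (mk (xLeafL 0 1)) _, ← seq_assoc (mk (Z 1 2 0)) (mk (wires 1) ⊠ mk (xLeafL 0 1)) _, ← seq_assoc (mk (xLeafL 0 1)) _ (mk (wires 1) ⊠ (mk (Z 1 1 1) ⨟ mk (X 1 1 2))),
    ← seq_assoc (mk (xLeafL 0 1)) (mk (Z 1 2 0)) (mk (wires 1) ⊠ mk (xLeafL 0 1)), xLeafL_split_xLeafL_eq, m5_l122, m5_r112]

/-- **Left half of the Lemma-35 chain**: `√2 ⊗ (F ⨾ (𝕀 ⊗ T))`, `F` the W-fork, equals the scalars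
`X_π Z(-π/2) ⊗ X_π Z(π/4) ⊗ 1/√2 ⊗ X_π Z(π/4) ⊗ √2 ⊗` the left spine form `Z(-π/2) ⨾ H ⨾ FORM_L`.
[cite: JeandelPerdrixVilmart2018, Appendix, proof of Lemma 35, figs. `…c1_00 → 06`] -/
theorem L35_left : mk (dumbbell 0 0) ⊠ (mk (Z 1 2 0) ⨟ (mk (wires 1) ⊠ (mk triangle ⨟ mk (Z 1 2 0))) ⨟ (mk (X 2 1 0) ⊠ mk (wires 1)) ⨟ (mk (wires 1) ⊠ mk triangle)) = mk (dumbbell 4 (-2)) ⊠ (mk (dumbbell 4 1) ⊠ (mk invSqrtTwo ⊠ (mk (dumbbell 4 1) ⊠ (mk (dumbbell 0 0) ⊠ (mk (Z 1 1 (-2)) ⨟ mk hBox ⨟ (mk (X 1 2 0) ⨟ ((mk (Z 1 1 (-3)) ⨟ (mk (X 1 3 0) ⨟ ((mk (Z 1 0 1) ⊠ mk (wires 1)) ⊠ mk (wires 1)) ⨟ ((mk (Z 1 1 1) ⨟ mk (X 1 2 0)) ⊠ mk (wires 1)) ⨟ (mk (wires 1) ⊠ mk (Z 2 1 0))) ⨟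 (mk (wires 1) ⊠ (mk (Z 1 1 1) ⨟ mk (X 1 1 2)))) ⊠ mk hBox) ⨟ (mk (wires 1) ⊠ mk swap) ⨟ (mk (X 2 1 0) ⊠ mk (wires 1)))))))) := by
  nth_rewrite 1 [triangle_eq_conj_transpose]
  rw [seq_assoc _ (mk (X 2 1 0) ⊠ mk (wires 1)) (mk (wires 1) ⊠ mk triangle), xmerge_par_seq_wire_par, ← seq_assoc _ (mk (wires 2) ⊠ mk triangle) (mk (X 2 1 0) ⊠ mk (wires 1)),
    seq_assoc (mk (Z 1 2 0)) _ (mk (wires 2) ⊠ mk triangle), show mk (wires 2) ⊠ mk triangle = mk (wires 1) ⊠ (mk (wires 1) ⊠ mk triangle) from by rw [← wires_par_wires 1 1]; exact (par_assoc _ _ _).trans (cast_id _ _ _),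
    ← wires_par_seq, Xpi_triangleT_Xpi, mk_triangle]
  simp only [seq_assoc]
  rw [gadgets_cancel_one, m5_r112, m5_r112, m5_r112, m5_w_s_12, m5_l232, m5_r122, scalar_par_scalar_par (mk (dumbbell 0 0)) (mk (dumbbell 4 (-2))),
    ← m5_r122, ← m5_l232, ← m5_w_s_12, top_picom, m5_w_s_12, m5_l232, m5_r122, ← seq_assoc (mk (X 1 1 2)) (mk (Z 1 1 (-1))) _, X_two_seq_Z_neg_one_eq,
    m5_l112, m5_l112, m5_w_s_12, m5_w_s_12, m5_l232, m5_l232, m5_r122, m5_r122,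
    split_seq_wire_par_block_seq_xmerge, split_seq_topBlock, leftBlock_bialgebra, m5_sCH, m5_l232, m5_r122, m5_r112, m5_r112]
  simp only [seq_assoc]

/-- Scalar mover (bookkeeping): `A ⨾ (s ⊗ B) = s ⊗ (A ⨾ B)` for `A : 2 → 2`, `B : 2 → 2`. [folklore] -/
private theorem m5_r222 (A : ZXClass 2 2) (s : ZXClass 0 0) (B : ZXClass 2 2) : A ⨟ (s ⊠ B) = s ⊠ (A ⨟ B) := by
  rw [scalar_par_seq_right, empty_par, cast_id]

/-- Scalar mover (bookkeeping): `(s ⊗ A) ⨾ B = s ⊗ (A ⨾ B)` for `A : 1 → 3`, `B : 3 → 2`. [folklore] -/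
private theorem m5_l132 (s : ZXClass 0 0) (A : ZXClass 1 3) (B : ZXClass 3 2) : (s ⊠ A) ⨟ B = s ⊠ (A ⨟ B) := by
  rw [scalar_par_seq_left, empty_par, cast_id]

/-- The two gadgets of Lemma 35 cancel — continuation form for the right half (the fork's merge follows).
[cite: JeandelPerdrixVilmart2018, Lemma (supplementarity to −π/4); Appendix, proof of Lemma 35, fig. `…c1_14 → 13`] -/
theorem gadgets_cancel_cps (R : ZXClass 1 2) (Q : ZXClass 3 2) :
    mk (Z 1 2 0) ⨟ ((mk (wires 1) ⊠ (mk (X 1 2 4) ⨟ (mk (Z 1 0 (-1)) ⊠ mk (Z 1 0 (-1))))) ⨟ (mk (Z 1 2 0) ⨟ ((mk (wires 1) ⊠ (mk (Z 1 2 0) ⨟ ((mk (wires 1) ⊠ (mk (X 1 2 0) ⨟ (mk (Z 1 0 (-1)) ⊠ mk (Z 1 0 (-1))))) ⨟ R))) ⨟ Q))) = mk (dumbbell 4 (-2)) ⊠ (mk (Z 1 2 0) ⨟ ((mk (wires 1) ⊠ R) ⨟ Q)) := by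
  rw [← seq_assoc (mk (Z 1 2 0)) (mk (wires 1) ⊠ (mk (Z 1 2 0) ⨟ ((mk (wires 1) ⊠ (mk (X 1 2 0) ⨟ (mk (Z 1 0 (-1)) ⊠ mk (Z 1 0 (-1))))) ⨟ R))) Q, ← seq_assoc (mk (wires 1) ⊠ (mk (X 1 2 4) ⨟ (mk (Z 1 0 (-1)) ⊠ mk (Z 1 0 (-1))))) _ Q, ← seq_assoc (mk (Z 1 2 0)) ((mk (wires 1) ⊠ (mk (X 1 2 4) ⨟ (mk (Z 1 0 (-1)) ⊠ mk (Z 1 0 (-1))))) ⨟ _) Q,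
    gadgets_cancel_two, m5_l132, seq_assoc]

/-- **Euler decomposition inside the right half** (fig. `…c1_13 → 12`): `Z(π/4) ⨾ X(π/2) ⨾ Z^{(1,2)} = (1/√2)·(X_π Z(π/4)) ⊗ (Z(-π/4) ⨾ H ⨾ Z^{(1,2)}(-π/2))`.
[cite: JeandelPerdrixVilmart2018, Lemma (Euler decomposition with scalars) via `euler_pos`, rule (S1)] -/
theorem Z_one_seq_X_two_seq_split : mk (Z 1 1 1) ⨟ (mk (X 1 1 2) ⨟ mk (Z 1 2 0)) = mk invSqrtTwo ⊠ (mk (dumbbell 4 1) ⊠ (mk (Z 1 1 (-1)) ⨟ (mk hBox ⨟ mk (Z 1 2 (-2))))) := by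
  rw [show mk (Z 1 1 1) = mk (Z 1 1 (-1)) ⨟ mk (Z 1 1 2) from by rw [phase_seq_phase, show (-1 : ZMod 8) + 2 = 1 from by decide],
    show mk (Z 1 2 0) = mk (Z 1 1 2) ⨟ mk (Z 1 2 (-2)) from by rw [Z_seq_Z 1 1 2 le_rfl, show (2 : ZMod 8) + -2 = 0 from by decide],
    ← seq_assoc (mk (X 1 1 2)) (mk (Z 1 1 2)) _, seq_assoc (mk (Z 1 1 (-1))) (mk (Z 1 1 2)) _, ← seq_assoc (mk (Z 1 1 2)) (mk (X 1 1 2) ⨟ mk (Z 1 1 2)) _,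
    ← seq_assoc (mk (Z 1 1 2)) (mk (X 1 1 2)) (mk (Z 1 1 2)), euler_pos, m5_l112, m5_l112, m5_r112, m5_r112]

/-- Colour change of the phased split behind a Hadamard (fig. `…c1_12 → 11`): `H ⨾ Z^{(1,2)}(-π/2) = X^{(1,2)}(-π/2) ⨾ (H ⊗ H)`.
[cite: JeandelPerdrixVilmart2018, rule (H), Lemma (Hadamard involution)] -/
theorem hBox_seq_Z_split_neg_two : mk hBox ⨟ mk (Z 1 2 (-2)) = mk (X 1 2 (-2)) ⨟ (mk hBox ⊠ mk hBox) := by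
  rw [Z_eq_conj 1 2 (-2), hTensor_one, hTensor_two, ← seq_assoc, ← seq_assoc, hBox_seq_hBox, id_seq]

/-- The bialgebra step inside the right half, continuation form. [cite: JeandelPerdrixVilmart2018, rules (B2), (S1); fig. `…c1_11 → 10`] -/
theorem rightBlock_bialgebra (R' : ZXClass 1 2) (Q : ZXClass 3 2) :
    mk (xLeafL 0 1) ⨟ (mk (Z 1 2 0) ⨟ ((mk (wires 1) ⊠ (mk (xLeafL 0 1) ⨟ R')) ⨟ Q)) = mk (dumbbell 0 0) ⊠ ((mk (X 1 3 0) ⨟ ((mk (Z 1 0 1) ⊠ mk (wires 1)) ⊠ mk (wires 1)) ⨟ ((mk (Z 1 1 1) ⨟ mk (X 1 2 0)) ⊠ mk (wires 1)) ⨟ (mk (wires 1) ⊠ mk (Z 2 1 0))) ⨟ ((mk (wires 1) ⊠ R') ⨟ Q)) := by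
  rw [wires_par_seq 1 (mk (xLeafL 0 1)) R', seq_assoc (mk (wires 1) ⊠ mk (xLeafL 0 1)) (mk (wires 1) ⊠ R') Q, ← seq_assoc (mk (Z 1 2 0)) (mk (wires 1) ⊠ mk (xLeafL 0 1)) _,
    ← seq_assoc (mk (xLeafL 0 1)) _ ((mk (wires 1) ⊠ R') ⨟ Q), ← seq_assoc (mk (xLeafL 0 1)) (mk (Z 1 2 0)) (mk (wires 1) ⊠ mk (xLeafL 0 1)), xLeafL_split_xLeafL_eq, m5_l122]

/-- Scalar mover (bookkeeping): `A ⊗ (s ⊗ B) = s ⊗ (A ⊗ B)` for `A B : 1 → 1`. [folklore] -/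
private theorem m5_p11 (A : ZXClass 1 1) (s : ZXClass 0 0) (B : ZXClass 1 1) : A ⊠ (s ⊠ B) = s ⊠ (A ⊠ B) := by
  rw [par_eq_seq_left A (s ⊠ B), ← scalar_par_wires_par_one, m5_r222, ← par_eq_seq_left]

/-- **Preparing Lemma (control-π / anti-CNOT commute)** (fig. `…c1_11 → 10`, Euler on the last wire): `X^{(1,2)}(-π/2) ⨾ (H ⊗ H) =
(1/√2)·Z_0(-π/2) ⊗ (X^{(1,2)} ⨾ (H ⊗ (Z(π/2) ⨾ X(π/2))))`. [cite: JeandelPerdrixVilmart2018, rules (S1), (H), Lemma (Euler decomposition of H)] -/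
theorem X_split_neg_two_seq_hBoxes : mk (X 1 2 (-2)) ⨟ (mk hBox ⊠ mk hBox) = mk invSqrtTwo ⊠ (mk (Z 0 0 (-2)) ⊠ (mk (X 1 2 0) ⨟ (mk hBox ⊠ (mk (Z 1 1 2) ⨟ mk (X 1 1 2))))) := by
  have hx : mk (X 1 1 (-2)) ⨟ mk hBox = mk hBox ⨟ mk (Z 1 1 (-2)) := by
    rw [X_phase_eq, seq_assoc, seq_assoc, hBox_seq_hBox, seq_id]
  have hh : mk hBox ⨟ mk (Z 1 1 (-2)) = mk invSqrtTwo ⊠ (mk (Z 0 0 (-2)) ⊠ (mk (Z 1 1 2) ⨟ mk (X 1 1 2))) := by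
    rw [hBox_eq_euler, scalar_par_seq_one, scalar_par_seq_one, seq_assoc, seq_assoc, phase_seq_phase, show (2 : ZMod 8) + -2 = 0 from by decide, Z_one_one, seq_id]
  rw [show mk (X 1 2 (-2)) = mk (X 1 2 0) ⨟ (mk (wires 1) ⊠ mk (X 1 1 (-2))) from by rw [X_seq_par_X 1 1 1 1 le_rfl, zero_add], seq_assoc, interchange, id_seq, hx, hh,
    m5_p11, m5_p11, m5_r122, m5_r122]

/-- Regrouping (bookkeeping): `(A ⊗ 𝕀) ⊗ 𝕀 = A ⊗ 𝕀²` for `A : 2 → 1`. [folklore] -/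
private theorem m5_rg21x (A : ZXClass 2 1) : (A ⊠ mk (wires 1)) ⊠ mk (wires 1) = A ⊠ mk (wires 2) := by
  rw [← wires_par_wires 1 1]; exact (par_assoc _ _ _).trans (cast_id _ _ _)

/-- **Lemma (control-π and anti-CNOT commute), transposed**: `Z^{(1,2)}(π) ⨾ (𝕀 ⊗ (X^{(1,2)} ⨾ (H ⊗ 𝕀))) ⨾ (X^{(2,1)} ⊗ 𝕀) =
X^{(1,2)} ⨾ (H ⊗ Z^{(1,2)}(π)) ⨾ (X^{(2,1)} ⊗ 𝕀)`. [cite: JeandelPerdrixVilmart2018, Appendix Lemma (control-π and anti-CNOT commute), transposed] -/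
theorem control_pi_anticnot_comm_transpose :
    mk (Z 1 2 4) ⨟ ((mk (wires 1) ⊠ (mk (X 1 2 0) ⨟ (mk hBox ⊠ mk (wires 1)))) ⨟ (mk (X 2 1 0) ⊠ mk (wires 1))) = mk (X 1 2 0) ⨟ ((mk hBox ⊠ mk (Z 1 2 4)) ⨟ (mk (X 2 1 0) ⊠ mk (wires 1))) := by
  have h := congrArg ZXClass.transpose control_pi_anticnot_comm
  simp only [transpose_seq, transpose_par, transpose_mk, ZXDiagram.transpose_Z, ZXDiagram.transpose_X, ZXDiagram.transpose_wires,
    ZXDiagram.transpose_cap, ZXDiagram.transpose_hBox] at h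
  have hb : ((mk (wires 1) ⊠ mk cup) ⊠ mk (wires 1)) ⨟ (mk (X 2 1 0) ⊠ mk (Z 2 1 4)) = (mk (wires 1) ⊠ mk (Z 1 2 4)) ⨟ (mk (X 2 1 0) ⊠ mk (wires 1)) := by
    rw [par_eq_seq_right (mk (X 2 1 0)) (mk (Z 2 1 4)), ← seq_assoc, show (mk (wires 1) ⊠ mk cup) ⊠ mk (wires 1) = mk (wires 1) ⊠ (mk cup ⊠ mk (wires 1)) from (par_assoc _ _ _).trans (cast_id _ _ _),
      show mk (wires 2) ⊠ mk (Z 2 1 4) = mk (wires 1) ⊠ (mk (wires 1) ⊠ mk (Z 2 1 4)) from by rw [← wires_par_wires 1 1]; exact (par_assoc _ _ _).trans (cast_id _ _ _),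
      ← wires_par_seq, show mk (Z 2 1 4) = mk (Z 2 1 0) ⨟ mk (Z 1 1 4) from by rw [Z_seq_Z 2 1 1 le_rfl, zero_add], wires_par_seq 1 (mk (Z 2 1 0)) (mk (Z 1 1 4)),
      ← seq_assoc (mk cup ⊠ mk (wires 1)) (mk (wires 1) ⊠ mk (Z 2 1 0)) _, spider_bend, Z_seq_par_Z 1 1 1 1 le_rfl, zero_add (4 : ZMod 8)]
  rw [hb, ← seq_assoc (mk hBox ⊠ mk (wires 1)) (mk (wires 1) ⊠ mk (Z 1 2 4)) _, interchange, seq_id, id_seq] at h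
  exact h

/-- X-spider bookkeeping: merging three wires two ways. [cite: JeandelPerdrixVilmart2018, rule (S1)] -/
theorem xmerge_par_seq_xmerge_eq : (mk (X 2 1 0) ⊠ mk (wires 1)) ⨟ mk (X 2 1 0) = (mk (wires 1) ⊠ mk (X 2 1 0)) ⨟ mk (X 2 1 0) := by
  rw [X_par_seq_X 2 1 1 1 le_rfl, par_X_seq_X 1 2 1 1 le_rfl]

/-- **The control-π / anti-CNOT step of Lemma 35 in merged `1 → 2` form** (fig. `…c1_10 → 09`):
`Z^{(1,2)}(-π/4) ⨾ (𝕀 ⊗ (X^{(1,2)} ⨾ (H ⊗ (Z(π/2) ⨾ X(π/2))))) ⨾ (X^{(2,1)} ⊗ 𝕀) = Z(3π/4) ⨾ X^{(1,2)} ⨾ (H ⊗ (Z^{(1,2)}(-π/2) ⨾ (𝕀 ⊗ X(π/2)))) ⨾ (X^{(2,1)} ⊗ 𝕀)`.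
[cite: JeandelPerdrixVilmart2018, Appendix Lemma (control-π and anti-CNOT commute), rule (S1)] -/
theorem E4_merged :
    mk (Z 1 2 (-1)) ⨟ ((mk (wires 1) ⊠ (mk (X 1 2 0) ⨟ (mk hBox ⊠ (mk (Z 1 1 2) ⨟ mk (X 1 1 2))))) ⨟ (mk (X 2 1 0) ⊠ mk (wires 1))) = mk (Z 1 1 3) ⨟ (mk (X 1 2 0) ⨟ ((mk hBox ⊠ (mk (Z 1 2 (-2)) ⨟ (mk (wires 1) ⊠ mk (X 1 1 2)))) ⨟ (mk (X 2 1 0) ⊠ mk (wires 1)))) := by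
  have hP : ∀ A : ZXClass 1 2, (mk (wires 1) ⊠ (mk (wires 1) ⊠ (mk (Z 1 1 2) ⨟ mk (X 1 1 2)))) ⨟ (mk (X 2 1 0) ⊠ mk (wires 1)) = (mk (X 2 1 0) ⊠ mk (wires 1)) ⨟ (mk (wires 1) ⊠ (mk (Z 1 1 2) ⨟ mk (X 1 1 2))) := fun _ => by
    rw [show mk (wires 1) ⊠ (mk (wires 1) ⊠ (mk (Z 1 1 2) ⨟ mk (X 1 1 2))) = mk (wires 2) ⊠ (mk (Z 1 1 2) ⨟ mk (X 1 1 2)) from by rw [← wires_par_wires 1 1]; exact (par_assoc' _ _ _).trans (cast_id _ _ _), interchange, id_seq, seq_id,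
      interchange, seq_id, id_seq]
  have hL : mk (wires 1) ⊠ (mk (X 1 2 0) ⨟ (mk hBox ⊠ (mk (Z 1 1 2) ⨟ mk (X 1 1 2)))) = (mk (wires 1) ⊠ (mk (X 1 2 0) ⨟ (mk hBox ⊠ mk (wires 1)))) ⨟ (mk (wires 1) ⊠ (mk (wires 1) ⊠ (mk (Z 1 1 2) ⨟ mk (X 1 1 2)))) := by
    rw [par_eq_seq_left (mk hBox) (mk (Z 1 1 2) ⨟ mk (X 1 1 2)), ← seq_assoc, wires_par_seq]
  have hR : mk hBox ⊠ (mk (Z 1 2 (-2)) ⨟ (mk (wires 1) ⊠ mk (X 1 1 2))) = (mk hBox ⊠ mk (Z 1 2 4)) ⨟ (mk (wires 1) ⊠ (mk (wires 1) ⊠ (mk (Z 1 1 2) ⨟ mk (X 1 1 2)))) := by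
    rw [show mk (Z 1 2 (-2)) = mk (Z 1 2 4) ⨟ (mk (wires 1) ⊠ mk (Z 1 1 2)) from by rw [Z_seq_par_Z 1 1 1 1 le_rfl, show (4 : ZMod 8) + 2 = -2 from by decide], seq_assoc, ← wires_par_seq,
      show mk hBox ⊠ (mk (Z 1 2 4) ⨟ (mk (wires 1) ⊠ (mk (Z 1 1 2) ⨟ mk (X 1 1 2)))) = (mk hBox ⨟ mk (wires 1)) ⊠ (mk (Z 1 2 4) ⨟ (mk (wires 1) ⊠ (mk (Z 1 1 2) ⨟ mk (X 1 1 2)))) from by rw [seq_id], ← interchange]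
  rw [show mk (Z 1 2 (-1)) = mk (Z 1 1 3) ⨟ mk (Z 1 2 4) from by rw [Z_seq_Z 1 1 2 le_rfl, show (3 : ZMod 8) + 4 = -1 from by decide], hL, hR, seq_assoc, seq_assoc, hP (mk (X 1 2 0)),
    seq_assoc (mk hBox ⊠ mk (Z 1 2 4)) _ _, hP (mk (X 1 2 0)), ← seq_assoc (mk (wires 1) ⊠ (mk (X 1 2 0) ⨟ (mk hBox ⊠ mk (wires 1)))) (mk (X 2 1 0) ⊠ mk (wires 1)) _,
    ← seq_assoc (mk (Z 1 2 4)) _ (mk (wires 1) ⊠ (mk (Z 1 1 2) ⨟ mk (X 1 1 2))), control_pi_anticnot_comm_transpose, seq_assoc, seq_assoc]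

/-- X-spider bookkeeping: merging the last three of four wires two ways (bookkeeping). [cite: JeandelPerdrixVilmart2018, rule (S1)] -/
theorem wire_par_seq_xmerges (E : ZXClass 1 3) :
    ((mk (wires 1) ⊠ E) ⨟ ((mk (X 2 1 0) ⊠ mk (wires 1)) ⊠ mk (wires 1))) ⨟ (mk (X 2 1 0) ⊠ mk (wires 1)) = (mk (wires 1) ⊠ (E ⨟ (mk (X 2 1 0) ⊠ mk (wires 1)))) ⨟ (mk (X 2 1 0) ⊠ mk (wires 1)) := by
  rw [seq_assoc, ← seq_par_wires, xmerge_par_seq_xmerge_eq, seq_par_wires, show (mk (wires 1) ⊠ mk (X 2 1 0)) ⊠ mk (wires 1) = mk (wires 1) ⊠ (mk (X 2 1 0) ⊠ mk (wires 1)) from (par_assoc _ _ _).trans (cast_id _ _ _),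
    ← seq_assoc, ← wires_par_seq]

/-- **The control-π / anti-CNOT step of Lemma 35 in the `2 → 2` form of the right half of the chain** (`E4′`).
[cite: JeandelPerdrixVilmart2018, Appendix Lemma (control-π and anti-CNOT commute), rule (S1), `cnot_alt`] -/
theorem E4_prime : ((mk (Z 1 1 1) ⨟ mk (X 1 2 0)) ⊠ mk (wires 1)) ⨟ (mk (wires 1) ⊠ (mk (Z 2 1 0) ⨟ mk (Z 1 1 (-1)) ⨟ mk (X 1 2 0) ⨟ (mk hBox ⊠ (mk (Z 1 1 2) ⨟ mk (X 1 1 2))))) ⨟ (mk (X 2 1 0) ⊠ mk (wires 1)) = (mk (Z 1 1 1) ⊠ (mk (Z 1 1 3) ⨟ mk (X 1 2 0) ⨟ (mk hBox ⊠ (mk (Z 1 2 (-2)) ⨟ (mk (wires 1) ⊠ mk (X 1 1 2)))))) ⨟ ((mk (X 2 1 0) ⊠ mk (wires 1)) ⊠ mk (wires 1)) ⨟ (mk (X 2 1 0) ⊠ mk (wires 1)) := by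
  have hx : ∀ B' : ZXClass 1 2, (mk (X 2 1 0) ⊠ mk (wires 1)) ⨟ (mk (wires 1) ⊠ B') = (mk (wires 2) ⊠ B') ⨟ ((mk (X 2 1 0) ⊠ mk (wires 1)) ⊠ mk (wires 1)) := fun B' => by
    rw [interchange, seq_id, id_seq, m5_rg21x, interchange, id_seq, seq_id]
  have hz : ∀ B' : ZXClass 1 2, (mk (wires 1) ⊠ mk (Z 1 2 0)) ⨟ (mk (wires 2) ⊠ B') = mk (wires 1) ⊠ (mk (Z 1 2 0) ⨟ (mk (wires 1) ⊠ B')) := fun B' => by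
    rw [show mk (wires 2) ⊠ B' = mk (wires 1) ⊠ (mk (wires 1) ⊠ B') from by rw [← wires_par_wires 1 1]; exact (par_assoc _ _ _).trans (cast_id _ _ _), ← wires_par_seq]
  have e1 : ((mk (Z 1 1 1) ⨟ mk (X 1 2 0)) ⊠ mk (wires 1)) ⨟ (mk (wires 1) ⊠ (mk (Z 2 1 0) ⨟ mk (Z 1 1 (-1)) ⨟ mk (X 1 2 0) ⨟ (mk hBox ⊠ (mk (Z 1 1 2) ⨟ mk (X 1 1 2))))) =
      (mk (Z 1 1 1) ⊠ mk (wires 1)) ⨟ ((mk (wires 1) ⊠ (mk (Z 1 2 (-1)) ⨟ (mk (wires 1) ⊠ (mk (X 1 2 0) ⨟ (mk hBox ⊠ (mk (Z 1 1 2) ⨟ mk (X 1 1 2))))))) ⨟ ((mk (X 2 1 0) ⊠ mk (wires 1)) ⊠ mk (wires 1))) := by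
    rw [seq_par_wires, seq_assoc (mk (Z 2 1 0)) (mk (Z 1 1 (-1))) _, seq_assoc (mk (Z 2 1 0)) _ _, wires_par_seq 1 (mk (Z 2 1 0)) _, seq_assoc,
      ← seq_assoc (mk (X 1 2 0) ⊠ mk (wires 1)) (mk (wires 1) ⊠ mk (Z 2 1 0)) _, ← cnot21_eq, seq_assoc (mk (wires 1) ⊠ mk (Z 1 2 0)) (mk (X 2 1 0) ⊠ mk (wires 1)) _, hx,
      ← seq_assoc (mk (wires 1) ⊠ mk (Z 1 2 0)) _ _, hz, seq_assoc (mk (Z 1 1 (-1))) (mk (X 1 2 0)) (mk hBox ⊠ (mk (Z 1 1 2) ⨟ mk (X 1 1 2))), wires_par_seq 1 (mk (Z 1 1 (-1))) _,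
      ← seq_assoc (mk (Z 1 2 0)) (mk (wires 1) ⊠ mk (Z 1 1 (-1))) _, Z_seq_par_Z 1 1 1 1 le_rfl, zero_add]
  rw [e1, seq_assoc (mk (Z 1 1 1) ⊠ mk (wires 1)) _ (mk (X 2 1 0) ⊠ mk (wires 1)), wire_par_seq_xmerges, seq_assoc (mk (Z 1 2 (-1))) _ (mk (X 2 1 0) ⊠ mk (wires 1)), E4_merged, par_eq_seq_left (mk (Z 1 1 1)) ((mk (Z 1 1 3) ⨟ mk (X 1 2 0)) ⨟ (mk hBox ⊠ (mk (Z 1 2 (-2)) ⨟ (mk (wires 1) ⊠ mk (X 1 1 2))))),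
    seq_assoc (mk (Z 1 1 1) ⊠ mk (wires 1)) (mk (wires 1) ⊠ ((mk (Z 1 1 3) ⨟ mk (X 1 2 0)) ⨟ (mk hBox ⊠ (mk (Z 1 2 (-2)) ⨟ (mk (wires 1) ⊠ mk (X 1 1 2)))))) _, seq_assoc (mk (Z 1 1 1) ⊠ mk (wires 1)) _ (mk (X 2 1 0) ⊠ mk (wires 1)),
    wire_par_seq_xmerges]
  simp only [seq_assoc]

/-- Reshaping the right half after the bialgebra step into the `E4′` redex (bookkeeping). [folklore] (PROP axioms) -/
theorem rightHalf_reshape :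
    (((mk (X 1 3 0) ⨟ ((mk (Z 1 0 1) ⊠ mk (wires 1)) ⊠ mk (wires 1))) ⨟ ((mk (Z 1 1 1) ⨟ mk (X 1 2 0)) ⊠ mk (wires 1))) ⨟ (mk (wires 1) ⊠ mk (Z 2 1 0))) ⨟ ((mk (wires 1) ⊠ (mk (Z 1 1 (-1)) ⨟ (mk (X 1 2 0) ⨟ (mk hBox ⊠ (mk (Z 1 1 2) ⨟ mk (X 1 1 2)))))) ⨟ (mk (X 2 1 0) ⊠ mk (wires 1))) =
      (mk (X 1 3 0) ⨟ ((mk (Z 1 0 1) ⊠ mk (wires 1)) ⊠ mk (wires 1))) ⨟ ((((mk (Z 1 1 1) ⨟ mk (X 1 2 0)) ⊠ mk (wires 1)) ⨟ (mk (wires 1) ⊠ (mk (Z 2 1 0) ⨟ mk (Z 1 1 (-1)) ⨟ mk (X 1 2 0) ⨟ (mk hBox ⊠ (mk (Z 1 1 2) ⨟ mk (X 1 1 2)))))) ⨟ (mk (X 2 1 0) ⊠ mk (wires 1))) := by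
  rw [seq_assoc (mk (X 1 3 0) ⨟ ((mk (Z 1 0 1) ⊠ mk (wires 1)) ⊠ mk (wires 1))) _ _, seq_assoc (mk (X 1 3 0) ⨟ ((mk (Z 1 0 1) ⊠ mk (wires 1)) ⊠ mk (wires 1))) _ _,
    seq_assoc ((mk (Z 1 1 1) ⨟ mk (X 1 2 0)) ⊠ mk (wires 1)) (mk (wires 1) ⊠ mk (Z 2 1 0)) _,
    ← seq_assoc (mk (wires 1) ⊠ mk (Z 2 1 0)) (mk (wires 1) ⊠ (mk (Z 1 1 (-1)) ⨟ (mk (X 1 2 0) ⨟ (mk hBox ⊠ (mk (Z 1 1 2) ⨟ mk (X 1 1 2)))))) _, ← wires_par_seq,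
    ← seq_assoc (mk (Z 2 1 0)) (mk (Z 1 1 (-1))) _, ← seq_assoc (mk (Z 2 1 0) ⨟ mk (Z 1 1 (-1))) (mk (X 1 2 0)) _, ← seq_assoc ((mk (Z 1 1 1) ⨟ mk (X 1 2 0)) ⊠ mk (wires 1)) _ (mk (X 2 1 0) ⊠ mk (wires 1))]

/-- Cancelling the scalars of the right half: `(1/√2) ⊗ (X_π Z(−π/4)) ⊗ (1/√2) ⊗ (X_π Z(π/4)) ⊗ D = D`.
[cite: JeandelPerdrixVilmart2018, Lemmas (inverse rule), (multiplying global phases)] -/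
theorem scalars_cancel_one_two (X' : ZXClass 1 2) : mk invSqrtTwo ⊠ (mk (Z 0 0 (-2)) ⊠ (mk invSqrtTwo ⊠ (mk (dumbbell 4 1) ⊠ X'))) = X' := by
  rw [Z_dot_neg_two_eq, scalar_par_scalar_par (mk (dumbbell 4 (-1))) (mk invSqrtTwo),
    show mk (dumbbell 4 (-1)) ⊠ (mk (dumbbell 4 1) ⊠ X') = (mk (dumbbell 4 (-1)) ⊠ mk (dumbbell 4 1)) ⊠ X' from (par_assoc' _ _ _).trans (cast_id _ _ _),
    scalar_par_comm (mk (dumbbell 4 (-1))) (mk (dumbbell 4 1)), dumbbell_four_par_dumbbell_four_neg,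
    show (mk (dumbbell 0 0) ⊠ mk (dumbbell 0 0)) ⊠ X' = mk (dumbbell 0 0) ⊠ (mk (dumbbell 0 0) ⊠ X') from (par_assoc _ _ _).trans (cast_id _ _ _),
    invSqrtTwo_par_sqrt_two_par_one_two, invSqrtTwo_par_sqrt_two_par_one_two]

/-- **Right half of the Lemma-35 chain**: `√2 ⊗ (T ⨾ F)` equals the same scalars as the left half times the right spine form
`Z(-π/2) ⨾ H ⨾ coreR`. [cite: JeandelPerdrixVilmart2018, Appendix, proof of Lemma 35, figs. `…c1_14 → 08`] -/
theorem L35_right : mk (dumbbell 0 0) ⊠ (mk triangle ⨟ (mk (Z 1 2 0) ⨟ (mk (wires 1) ⊠ (mk triangle ⨟ mk (Z 1 2 0))) ⨟ (mk (X 2 1 0) ⊠ mk (wires 1)))) = mk (dumbbell 4 (-2)) ⊠ (mk (dumbbell 4 1) ⊠ (mk invSqrtTwo ⊠ (mk (dumbbell 4 1) ⊠ (mk (dumbbell 0 0) ⊠ (mk (Z 1 1 (-2)) ⨟ mk hBox ⨟ (mk (Z 1 1 (-3)) ⨟ mk (X 1 3 0) ⨟ ((mk (Z 1 0 1) ⊠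 mk (wires 1)) ⊠ mk (wires 1)) ⨟ ((mk (Z 1 1 1) ⊠ (mk (Z 1 1 3) ⨟ mk (X 1 2 0) ⨟ (mk hBox ⊠ (mk (Z 1 2 (-2)) ⨟ (mk (wires 1) ⊠ mk (X 1 1 2)))))) ⨟ ((mk (X 2 1 0) ⊠ mk (wires 1)) ⊠ mk (wires 1)) ⨟ (mk (X 2 1 0) ⊠ mk (wires 1))))))))) := by
  nth_rewrite 1 [triangle_eq_conj_transpose]
  rw [Xpi_triangleT_Xpi, mk_triangle]
  simp only [seq_assoc]
  rw [gadgets_cancel_cps, m5_r112, m5_r112, m5_r112, scalar_par_scalar_par (mk (dumbbell 0 0)) (mk (dumbbell 4 (-2))), top_picom,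
    Z_one_seq_X_two_seq_split, m5_r112, m5_r112, m5_w_s_12, m5_w_s_12, m5_l232, m5_l232, m5_r122, m5_r122, m5_r112, m5_r112, m5_r112, m5_r112, m5_r112, m5_r112,
    hBox_seq_Z_split_neg_two, rightBlock_bialgebra, m5_r112, m5_r112, X_split_neg_two_seq_hBoxes,
    m5_r112, m5_r112, m5_w_s_12, m5_w_s_12, m5_l232, m5_l232, m5_r122, m5_r122, m5_r112, m5_r112, m5_r112, m5_r112,
    rightHalf_reshape, E4_prime, ← seq_assoc (mk (X 1 1 2)) (mk (Z 1 1 (-1))) _, X_two_seq_Z_neg_one_eq, m5_l112, m5_l112, scalars_cancel_one_two]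
  simp only [seq_assoc]

/-- **Appendix Lemma 35 of JPV (LICS'18): the triangle passes through the W-fork** (`lem:n-four`, "triangle through W"):
`F ⨾ (𝕀 ⊗ T) = T ⨾ F` with `F := Z^{(1,2)} ⨾ (𝕀 ⊗ (T ⨾ Z^{(1,2)})) ⨾ (X^{(2,1)} ⊗ 𝕀)` the W-fork and `T` the triangle.
Proof: both sides times `√2` are brought to spine forms (`L35_left`, `L35_right`: definition of the triangle, supplementarity,
π-commutation, Euler decompositions, bialgebra, colour changes, control-π/anti-CNOT commutation), which agree by Appendix
Lemma 34 bent (`L35_mid`); then `√2` is cancelled. [cite: JeandelPerdrixVilmart2018, Appendix, Lemma 35 and its proof] -/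
theorem triangle_through_W : mk (Z 1 2 0) ⨟ (mk (wires 1) ⊠ (mk triangle ⨟ mk (Z 1 2 0))) ⨟ (mk (X 2 1 0) ⊠ mk (wires 1)) ⨟ (mk (wires 1) ⊠ mk triangle) = mk triangle ⨟ (mk (Z 1 2 0) ⨟ (mk (wires 1) ⊠ (mk triangle ⨟ mk (Z 1 2 0))) ⨟ (mk (X 2 1 0) ⊠ mk (wires 1))) := by
  have h : mk (dumbbell 0 0) ⊠ (mk (Z 1 2 0) ⨟ (mk (wires 1) ⊠ (mk triangle ⨟ mk (Z 1 2 0))) ⨟ (mk (X 2 1 0) ⊠ mk (wires 1)) ⨟ (mk (wires 1) ⊠ mk triangle)) = mk (dumbbell 0 0) ⊠ (mk triangle ⨟ (mk (Z 1 2 0) ⨟ (mk (wires 1) ⊠ (mk triangle ⨟ mk (Z 1 2 0))) ⨟ (mk (X 2 1 0) ⊠ mk (wires 1)))) := by rw [L35_left, L35_right, L35_mid]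
  have h2 := congrArg (fun D => mk invSqrtTwo ⊠ D) h
  simpa only [invSqrtTwo_par_sqrt_two_par_one_two] using h2

end ZXClass

end Literature.Computability.QuantumComplexity
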